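import Summits.QuantumFields.QCD.Theses.QuarksNoInfraredClause
import Literature.MathematicalPhysics.QuantumFieldTheory.QCDFlavourSymmetry
import Summits.QuantumFields.QCD.Theorems.QuarksNoInfraredClauseTorusHalfSpectrumStubSelectionRule
import Summits.QuantumFields.QCD.Theorems.QuarksNoInfraredClauseTorusHalfSpectrumStubHomogeneousReduction
import Summits.QuantumFields.QCD.Theorems.QuarksNoInfraredClauseTorusHalfSpectrumStubNeutralGapAlongAxes
import Summits.QuantumFields.QCD.Theorems.QuarksNoInfraredClauseTorusHalfSpectrumStubDetDiracMatrixPos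
import Summits.QuantumFields.QCD.Theorems.QuarksNoInfraredClauseTorusHalfSpectrumStubConjugateHeavyPathwise
import Summits.QuantumFields.QCD.Theorems.QuarksNoInfraredClauseTorusHalfSpectrumStubConjugateHeavy
import Summits.QuantumFields.QCD.Theorems.QuarksNoInfraredClauseTorusHalfSpectrumStubCompositeObservable
import Summits.QuantumFields.QCD.Theorems.QuarksNoInfraredClauseTorusHalfSpectrumStubOsAdjointCharge
import Summits.QuantumFields.QCD.Theorems.QuarksNoInfraredClauseTorusHalfSpectrumStubSupercommute
import Summits.QuantumFields.QCD.Theorems.QuarksNoInfraredClauseTorusHalfSpectrumStubFourPointRegroup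
import Summits.QuantumFields.QCD.Theorems.QuarksNoInfraredClauseTorusHalfSpectrumStubChargedAxisTransport
import Summits.QuantumFields.QCD.Theorems.QuarksNoInfraredClauseTorusHalfSpectrumStubHaagProductBound
import Summits.QuantumFields.QCD.Theorems.QuarksNoInfraredClauseTorusHalfSpectrumHeavyCorner
import Summits.QuantumFields.QCD.Theorems.QuarksNoInfraredClauseTorusHalfSpectrumStubEuclideanHaag
import Summits.QuantumFields.QCD.Theorems.QuarksNoInfraredClauseTorusHalfSpectrumStubGammaFiveConjExists
import Summits.QuantumFields.QCD.Theorems.QuarksNoInfraredClauseTorusHalfSpectrumStubGammaFiveConjExpect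
import Summits.QuantumFields.QCD.Theorems.QuarksNoInfraredClauseTorusHalfSpectrumStubGammaFiveConjExpectAP
import Summits.QuantumFields.QCD.Theorems.QuarksNoInfraredClauseTorusHalfSpectrumStubGammaFiveConjObservable
import Literature.MathematicalPhysics.QuantumFieldTheory.QCDGammaFiveConjugation
import Literature.MathematicalPhysics.QuantumFieldTheory.QCDTimeReflection
import Literature.MathematicalPhysics.QuantumFieldTheory.TransferDecayUpgrade
import HarnessLib.Audit

/-!
# Birth skeleton (BC3) for the crux `TorusHalfSpectrum` (item stmt-QuantumFields-9508) — reshape v6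

Reshape v6 (lead gen 1, continuation c4, `prover-line-stmt-QuantumFields-9508-c4-0`, 2026-08-17): the fourth
load-bearing ingredient of the light core identified by c3 — CHARGE-CONJUGATION SYMMETRY of the functional, the
partner Haag's product bound (E4/E5) needs to turn `d_A(n)·d_{A'}(n) ≤ M² r^{2n}` into the HALF rate
`d_A(n) ≤ M rⁿ` — is cut out and registered, provable now: the antilinear, order-PRESERVING `γ₅`-conjugation
`K` of the quark Grassmann algebra (`K ψ_{x,α} = −∑_σ ψ̄_{x,σ}(γ₅)_{σα}`, `K ψ̄_{x,α} = ∑_σ (γ₅)_{ασ} ψ_{x,σ}`,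
coefficients conjugated, links fixed; Literature definitions `torusK`, `fermiK`, `QCDLatticeObservable.kConj`
proposed as `QCDGammaFiveConjugation.lean`, p172263) is characterised intrinsically (`IsGammaFiveConj`, §0) so that
the four new registered stubs are self-contained over tree vocabulary: (K0) such a `K` EXISTS on every torus
algebra (`stub_gammaFiveConj_exists`); (K1) every such `K` fixes the periodic Wilson quark Boltzmann factor
(`γ₅`-hermiticity, `wilsonDirac_gammaFive_hermitian_holds`) and conjugates the statement's functional,
`⟨K∘X⟩ = conj ⟨X⟩` (`stub_gammaFiveConj_expect`; the Berezin Jacobian `det K₀` cancels between numerator and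
denominator whatever its value); (K1') the same for the time-ANTIPERIODIC functional `qcdTorusExpectAP`, the
reflection-positive family on which Haag's bound is run (`stub_gammaFiveConj_expectAP`); (K2) an observable-level
conjugation `A ↦ A^K` exists — again a `QCDLatticeObservable`, of OPPOSITE flavour charge, commuting with the
Osterwalder–Seiler adjoint `Θ` (`ΘK = KΘ` on generators since `γ₅γ₀ = −γ₀γ₅`, `γ₀` hermitian, `γ₅` real
diagonal), and placed on every torus by `(A^K).onTorus = K ∘ A.onTorus` for every `γ₅`-conjugation `K`
(`stub_gammaFiveConj_observable`).  Consequence used by the light core: for homogeneous `A` of charge `q ≠ 0`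
the partner `A' = A^K` has charge `−q` and `⟨ΘA'(u)·A'(v)⟩ = conj ⟨ΘA(u)·A(v)⟩` in either functional, so the
RP-diagonal correlators of `A` and `A'` coincide.  `LightCoreStmt` now receives K0–K2 (composition re-checked);
the registered signature of `stub_light_core_spectral` is unchanged (as with E1/E2/E4, the residual's prover
imports the landed files).  The v5 text follows.

# (v5 header) Birth skeleton (BC3) for the crux `TorusHalfSpectrum` — reshape v5

Reshape v5 (lead gen 1, continuation c3, `prover-line-stmt-QuantumFields-9508-c3-0`, 2026-08-17): three further
architecture-independent ingredients of the light core are cut out and registered, all provable now —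
(E1) the TORUS FOUR-POINT REGROUPING identity (stub `stub_fourPoint_regrouping`): the Euclidean four-point function
of four homogeneous placements `A(0) B(v) A'(w) B'(w+v)` is at once the two-point function `⟨M(0) M'(w)⟩` of the
time-split composites `M = A·τ_v B`, `M' = A'·τ_v B'` and `(−1)^{|q_B||q_{A'}|}` times the two-point function
`⟨N(0) N'(v)⟩` of the space-split composites `N = A·τ_w A'`, `N' = B·τ_w B'` (supercommutation G + translation
invariance) — Haag's splitting identity on the statement's own tori; (E2) the CHARGED hypercubic transport (stub
`stub_charged_axis_transport`): a pair correlator along the axis `i` is the time-axis correlator of an axis-permuted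
pair of the SAME flavour charges (the long-range-order term of Haag's identity at spatial distance `S` is the
antipodal TEMPORAL charged correlator `c_S(S)`, the `n = S` instance of the goal); (E4) HAAG'S PRODUCT BOUND in the
tree's `TransferData` vocabulary (stub `stub_haag_product_bound`): for a positive contraction `T` with vacuum `Ω`,
neutral vectors `w_j` clustering at rate `r²` with per-vector constants and thresholds, `‖w_j‖ ≤ M`, no long-range
order `⟪Ω, w_j⟫ → 0` and splitting `⟪w_j, Tⁿ w_j⟫ → ⟪v, Tⁿ v⟫⟪v', Tⁿ v'⟫` force
`re⟪v,Tⁿv⟫ · re⟪v',Tⁿv'⟫ ≤ M² r^{2n}` for EVERY `n` (decay upgrade `TransferDecayUpgrade` + limit) — the operator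
half of Haag's half-spectrum lemma; with a charge-conjugation partner `v'` of equal diagonal correlator each factor
decays at rate `r` with the NORM constant (`le_mul_pow_of_sq_le`, §3); its Euclidean/measure form for a
reflection-positive lattice measure with a MIXING spatial shift (`IsOSRealisation`; splitting and no-LRO derived from
mixing, composites `F·(F^c∘σ^j)`) is LANDED too (E5, registered sub-goal `stub_euclidean_haag_product_bound`, p167264) —
the infinite-volume half-spectrum template; and the HEAVY CORNER of the crux AS FILED is proved outright (registered
sub-goal `stub_heavyCorner_halfSpectrum`, p166446, §5).  The residual light core
(`stub_light_core_spectral`, held by the lead) now lists Θ, G, E1, E2, E4 as its inputs; what it still needs is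
named in the lead's PROMOTE-v3 / RESTATE-v3: the operator dictionary with quark insertions on the reflection-positive
thermal family (sister crux 9737, E1/E2 there), a UNIFORM (norm-constant) neutral bound for the `S`-dependent split
composites, charge-conjugation symmetry of the functional, absence of charged long-range order (Goldstone
alternative), and the symmetric-torus RETURN — on the symmetric torus the splitting distance is tied to the time
separation (`w ≤ S`, `n ≤ S`), so E1 returns the antipodal charged correlator `c_S(S)` as its own error term: the
torus-uniform HALF is a finite-volume charged-gap statement, reachable only through infinite volume + return.

# (v4 header) Birth skeleton (BC3) for the crux `TorusHalfSpectrum` — reshape v4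

Reshape v4 (lead gen 1, continuation c2, `prover-line-stmt-QuantumFields-9508-c2-0`, 2026-08-17): the
crux-sized light core of v3 is cut into the two architecture-independent lattice-side ingredients every
proof of it uses — the OS reflection `osAdjoint` FLIPS the flavour charge (stub Θ: so `A · τ_v ΘA` is a
NEUTRAL split composite the crux's hypothesis applies to) and torus placements of flavour-homogeneous
observables SUPERCOMMUTE with the sign `(−1)^{|q_A||q_B|}` (stub G: the regrouping of Euclidean 4-point
functions between the time grouping and the space grouping) — plus the residual SPECTRAL core
(`stub_light_core_spectral`, held by the lead: transfer/supertrace dictionary with quark insertions,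
decay-rate-to-norm upgrade, Haag splitting, symmetric-torus return).  Composition re-checked
(`conjugateHalfSpectrum_of` now threads Θ and G into the light core).  The v3 text follows.

# (v3 header) Birth skeleton for the crux `TorusHalfSpectrum` — reshape v3

Route `QuarksNoInfraredClause` (sub-problem QCD), crux decl
`Summit.QuantumFields.QCD.Theses.QuarksNoInfraredClause.TorusHalfSpectrum` (rank 2, XL; the torus-uniform
HALF-SPECTRUM lemma): along every asymptotically scaling scheme with bare masses eventually on the physical
branch, FLAVOUR-NEUTRAL lattice clustering at rate `2Δ` (quantifier shape of `HasLatticeMassGap`: per pair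
`∃ C, ∀ᶠ k`, all tori `S ≥ L_k`, all `n ≤ S`) implies ALL-PAIR clustering at rate `Δ`
(`sch.HasLatticeMassGap Δ`).  By `QCDFlavourSymmetry.lean` the crux is `Iff.rfl`-equal to
`… → sch.HasNeutralLatticeMassGap (2Δ) → sch.HasLatticeMassGap Δ`.

Registered by the skeleton-registrar seat `planner-skel-stmt-QuantumFields-9508-0` (2026-08-17) as
`Cruxes/TorusHalfSpectrum/Lines/birth.lean`; reshaped v2 by the gen-0 lead (2026-08-17, 4 stubs, 2 landed);
reshaped v3 by the gen-1 lead `prover-line-stmt-QuantumFields-9508-c1-0` (2026-08-17, this file).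

## Mechanism and cut

Weight decomposition under the abelian flavour torus (stub 1, LANDED) reduces the crux to HOMOGENEOUS pairs
`(q_A, q_B)`; `q_A = q_B = 0` is the crux's own hypothesis at the weaker rate; `q_A + q_B ≠ 0` is the exact
selection rule (stub 3a, LANDED: the connected correlator vanishes identically); the conjugate pairs
`(q, −q)`, `q ≠ 0` are the Haag–Lüscher half-spectrum theorem proper, fed by the COMMON-THRESHOLD neutral gap
(stub 2 = threshold uniformisation, the crux's recorded weak point).

## Reshape v3 (gen-1 lead): the conjugate stub cut into provable-now ingredients + the light core

* `stub_conjugate_heavy_pathwise` + `stub_det_diracMatrix_pos` + `stub_conjugate_heavy` — the HEAVY-MASS CORNER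
  is unconditional: if `∃ m₀ > 0` with `m_f(k) ≥ m₀` eventually, conjugate charged pairs cluster at EVERY rate
  `Δ·a_k` (no neutral hypothesis, no asymptotic scaling): charge `q ≠ 0` forces, in every Wick pattern, a quark
  line across the time gap, and `|D⁻¹(p,q)| ≤ m₀⁻¹ (4/(m₀+4))^{d₀(p,q)}` configuration-wise (tree
  `norm_inv_diracMatrix_apply_le_of_le`); `det D(U) > 0` for positive masses turns the pathwise bound into a
  bound on the honest ratio.  So the crux's open content is exactly the LIGHT window `m_f(k) → (−1, m₀)`.
* `stub_neutral_gap_along_axes` — the common-threshold neutral gap transported to every lattice axis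
  (hypercubic symmetry `axisPerm`; pattern of `HasLatticeMassGap.along_axis`): the spatial clustering the
  Haag splitting consumes.
* `stub_composite_observable` — the split composites `A · τ_v B` exist as `QCDLatticeObservable`s with
  additive flavour charge (so the neutral hypothesis APPLIES to `N_x = A · τ_x B`).
* `stub_conjugate_light_core` (held by the lead; crux-sized, honest status: research-level) — the
  Haag–Lüscher theorem proper in the light window, consuming the ingredients above (the charge flip under
  `osAdjoint`, a further small ingredient, is landed separately by the lead as a `--supports` helper).
* `stub_neutral_threshold_uniformisation` — UNCHANGED and MISSTATED as typed (gen-0 evidence: kernel-checked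
  counter-model of the quantifier shape; repair = common-threshold hypothesis written into the crux).

`conjugateHalfSpectrum_of` (heavy/light case split) and `TorusHalfSpectrum_of` are kernel-checked; every
registered stub carries a SELF-CONTAINED signature over tree vocabulary (§2) so that a stub-worker can land it
verbatim under `Theorems/`; the bridges `…_stmt` recover the §1 names by definitional unfolding.

## Negative knowledge honoured (read 2026-08-17, gen 1)
* `Cruxes/TorusHalfSpectrum/`: PICKED.md, PROMOTE-stub_conjugate_half_spectrum.md (gen 0), Lines/birth.{lean,md};
  no `Disproof.lean`, no crux ideas, no dead lines.
* Elementary finite-torus regrouping of the 4-point function `⟨A(0)B(n)A'(x)B'(n,x)⟩` (grouping by time vs by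
  space) does NOT prove the light core: it leaves the antipodal charged product `c(S)c'(S)` uncontrolled (the
  long-range-order obstruction); recorded in the lead's NOTES so it is not retried.
-/

noncomputable section

namespace Summit.QuantumFields.QCD.Cruxes.TorusHalfSpectrum.Birth

open scoped BigOperators InnerProductSpace
open Filter
open Literature.MathematicalPhysics.QuantumFieldTheory
open Summit.QuantumFields.QCD.Theses.QuarksNoInfraredClause (TorusHalfSpectrum)

/-! ## §0 Currency -/

/-- **Flavour-homogeneous observable of integer charge vector `q`**: the vector flavour torus
`t ∈ (ℂˣ)^{N_f}` (`QCDLatticeObservable.flavourScale t`: `ψ_f ↦ t_f ψ_f`, `ψ̄_f ↦ t_f⁻¹ ψ̄_f`) multiplies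
`A.F U` by the character `∏_f t_f^{q_f}` — every Grassmann monomial of `A.F U` has `#ψ_f − #ψ̄_f = q_f`.
Charge `0` is `IsFlavourNeutral`; a flavoured meson `ψ̄_u Γ ψ_d` has `q = (−1, 1, 0, …)`, a baryon has
`∑ q_f = 3`. -/
def IsFlavourHomogeneous {Nf R : ℕ} (A : QCDLatticeObservable Nf R) (q : Fin Nf → ℤ) : Prop :=
  ∀ t : Fin Nf → ℂ, (∀ f, t f ≠ 0) → ∀ U,
    QCDLatticeObservable.flavourScale t (A.F U) = (∏ f, t f ^ (q f)) • A.F U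

/-- **Rate-`Δ` clustering of ONE pair along the scheme, in the quantifier shape of `HasLatticeMassGap`**
(verbatim its body for the pair `A, B`). -/
def PairClusters {Nf R R' : ℕ} (sch : QCDScheme Nf) (Δ : ℝ)
    (A : QCDLatticeObservable Nf R) (B : QCDLatticeObservable Nf R') : Prop :=
  ∃ C : ℝ, ∀ᶠ k in atTop, ∀ S : ℕ, sch.L k ≤ S → ∀ n : ℕ, n ≤ S →
    ‖qcdLatticeConnectedCorr (sch.β k) (2 * S + 1) (fun fl => sch.mq fl k) A B n‖ ≤
      C * Real.exp (-(Δ * (sch.a k * n)))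

/-- **Common-threshold neutral lattice gap at rate `Δ'` from step `k₀` on**: EVERY pair of flavour-neutral
observables obeys its clustering bound on all tori `S ≥ L_k`, `n ≤ S`, for all `k ≥ k₀` (constants still
pair-dependent). -/
def UniformNeutralGapFrom {Nf : ℕ} (sch : QCDScheme Nf) (Δ' : ℝ) (k₀ : ℕ) : Prop :=
  ∀ (R R' : ℕ) (A : QCDLatticeObservable Nf R) (B : QCDLatticeObservable Nf R'),
    A.IsFlavourNeutral → B.IsFlavourNeutral → ∃ C : ℝ, ∀ k : ℕ, k₀ ≤ k →
      ∀ S : ℕ, sch.L k ≤ S → ∀ n : ℕ, n ≤ S →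
        ‖qcdLatticeConnectedCorr (sch.β k) (2 * S + 1) (fun fl => sch.mq fl k) A B n‖ ≤
          C * Real.exp (-(Δ' * (sch.a k * n)))

/-- **Common-threshold neutral lattice gap at rate `Δ'`** (`∃ k₀`; the uniform form of
`sch.HasNeutralLatticeMassGap Δ'`, where the threshold is per pair). -/
def UniformNeutralGap {Nf : ℕ} (sch : QCDScheme Nf) (Δ' : ℝ) : Prop :=
  ∃ k₀ : ℕ, UniformNeutralGapFrom sch Δ' k₀

/-- **Common-threshold neutral gap along the axis `i`** (the pair correlator with `B` translated by `n eᵢ`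
instead of `n e₀`; for `i = 0` this is `UniformNeutralGapFrom` by `qcdLatticeConnectedCorr`'s definition). -/
def UniformNeutralGapAlongFrom {Nf : ℕ} (sch : QCDScheme Nf) (Δ' : ℝ) (k₀ : ℕ) (i : Fin 4) : Prop :=
  ∀ (R R' : ℕ) (A : QCDLatticeObservable Nf R) (B : QCDLatticeObservable Nf R'),
    A.IsFlavourNeutral → B.IsFlavourNeutral → ∃ C : ℝ, ∀ k : ℕ, k₀ ≤ k →
      ∀ S : ℕ, sch.L k ≤ S → ∀ n : ℕ, n ≤ S →
        ‖qcdTorusExpect (sch.β k) (2 * S + 1) (fun fl => sch.mq fl k)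
              (fun U => A.onTorus (2 * S + 1) 0 U *
                B.onTorus (2 * S + 1) (Pi.single i (n : ℤ)) U) -
            qcdTorusExpect (sch.β k) (2 * S + 1) (fun fl => sch.mq fl k) (A.onTorus (2 * S + 1) 0) *
              qcdTorusExpect (sch.β k) (2 * S + 1) (fun fl => sch.mq fl k)
                (B.onTorus (2 * S + 1) (Pi.single i (n : ℤ)))‖ ≤
          C * Real.exp (-(Δ' * (sch.a k * n)))

/-- **The heavy-mass corner of a scheme**: one positive lower bound `m₀` for all bare masses eventually
(hopping parameters `κ_f(k) ≤ 1/(2m₀+8) < 1/8` eventually). -/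
def HeavyCorner {Nf : ℕ} (sch : QCDScheme Nf) : Prop :=
  ∃ m₀ : ℝ, 0 < m₀ ∧ ∀ fl : Fin Nf, ∀ᶠ k in atTop, m₀ ≤ sch.mq fl k

/-- **A `γ₅`-conjugation of the torus quark Grassmann algebra** (v6): a unital, additive, multiplicative
(ORDER-PRESERVING), antilinear self-map `K` with the generator values
`K ψ_{f,x,a,α} = −∑_σ (γ₅)_{σα} ψ̄_{f,x,a,σ}` and `K ψ̄_{f,x,a,α} = ∑_σ (γ₅)_{ασ} ψ_{f,x,a,σ}`.  These clauses
determine `K` uniquely (it is the Literature `torusK = Λ(K₀) ∘ conj` of `QCDGammaFiveConjugation.lean`,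
p172263); the intrinsic form keeps the registered stubs self-contained over landed vocabulary. -/
def IsGammaFiveConj {Nf S : ℕ} [NeZero S] (K : FermiAlg Nf S → FermiAlg Nf S) : Prop :=
  (∀ x y, K (x * y) = K x * K y) ∧ (∀ x y, K (x + y) = K x + K y) ∧
    (∀ (c : ℂ) (x : FermiAlg Nf S), K (c • x) = starRingEnd ℂ c • K x) ∧ K 1 = 1 ∧
    (∀ v : QuarkVar Nf S, K (_root_.Literature.MathematicalPhysics.QuantumFieldTheory.q v) =
      -∑ σ : Fin 4, _root_.Literature.MathematicalPhysics.QuantumLattice.gammaFive σ v.2.2.2 •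
        _root_.Literature.MathematicalPhysics.QuantumFieldTheory.qbar (v.1, (v.2.1, v.2.2.1, σ))) ∧
    (∀ v : QuarkVar Nf S, K (_root_.Literature.MathematicalPhysics.QuantumFieldTheory.qbar v) =
      ∑ σ : Fin 4, _root_.Literature.MathematicalPhysics.QuantumLattice.gammaFive v.2.2.2 σ •
        _root_.Literature.MathematicalPhysics.QuantumFieldTheory.q (v.1, (v.2.1, v.2.2.1, σ)))

/-! ## §1 Stub statements -/

/-- Stub K0 statement (v6) — **a `γ₅`-conjugation exists on every torus quark algebra** (witness: the
Literature `torusK`). -/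
def ConjugationExistsStmt : Prop :=
  ∀ (Nf S : ℕ) [NeZero S], ∃ K : FermiAlg Nf S → FermiAlg Nf S, IsGammaFiveConj K

/-- Stub K1 statement (v6) — **`γ₅`-conjugation symmetry of the statement's torus functional**: every
`γ₅`-conjugation fixes the periodic Wilson quark Boltzmann factor (`γ₅`-hermiticity `γ₅ D(U) γ₅ = D(U)†`)
and conjugates the honest signed functional, `⟨K ∘ X⟩_{β,S,m} = conj ⟨X⟩_{β,S,m}` for every Grassmann-valued
`X`, every `β`, all masses (the Berezin Jacobian cancels in the ratio whatever its value; junk `0/0` on both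
sides otherwise). -/
def ConjugationExpectStmt : Prop :=
  ∀ (Nf S : ℕ) [NeZero S] (K : FermiAlg Nf S → FermiAlg Nf S), IsGammaFiveConj K →
    (∀ (U : GaugeConfig 4 S (Matrix.specialUnitaryGroup (Fin 3) ℂ)) (mq : Fin Nf → ℝ),
        K (fermiBoltzmann U mq) = fermiBoltzmann U mq) ∧
      ∀ (β : ℝ) (mq : Fin Nf → ℝ)
        (X : GaugeConfig 4 S (Matrix.specialUnitaryGroup (Fin 3) ℂ) → FermiAlg Nf S),
        qcdTorusExpect β S mq (fun U => K (X U)) = starRingEnd ℂ (qcdTorusExpect β S mq X)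

/-- Stub K1' statement (v6) — **the same for the time-antiperiodic (reflection-positive) functional**
`qcdTorusExpectAP` (`γ₅`-hermiticity of the antiperiodic Wilson–Dirac matrix: the boundary signs are real). -/
def ConjugationExpectAPStmt : Prop :=
  ∀ (Nf S : ℕ) [NeZero S] (K : FermiAlg Nf S → FermiAlg Nf S), IsGammaFiveConj K →
    (∀ (U : GaugeConfig 4 S (Matrix.specialUnitaryGroup (Fin 3) ℂ)) (mq : Fin Nf → ℝ),
        K (fermiBoltzmannAP U mq) = fermiBoltzmannAP U mq) ∧
      ∀ (β : ℝ) (mq : Fin Nf → ℝ)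
        (X : GaugeConfig 4 S (Matrix.specialUnitaryGroup (Fin 3) ℂ) → FermiAlg Nf S),
        qcdTorusExpectAP β S mq (fun U => K (X U)) = starRingEnd ℂ (qcdTorusExpectAP β S mq X)

/-- Stub K2 statement (v6) — **the observable-level conjugation `A ↦ A^K`**: a self-map of gauge-invariant
local observables (witness: the Literature `QCDLatticeObservable.kConj`) reversing every flavour charge,
commuting with the Osterwalder–Seiler adjoint `Θ` (so `Θ(A^K) = (ΘA)^K` as Grassmann-valued functions and on
every torus), and placed on every torus through ANY `γ₅`-conjugation: `(A^K).onTorus S v U = K (A.onTorus S v U)`. -/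
def ConjugationObservableStmt : Prop :=
  ∃ Kobs : ∀ (Nf R : ℕ), QCDLatticeObservable Nf R → QCDLatticeObservable Nf R,
    (∀ (Nf R : ℕ) (A : QCDLatticeObservable Nf R) (qA : Fin Nf → ℤ),
        IsFlavourHomogeneous A qA → IsFlavourHomogeneous (Kobs Nf R A) (-qA)) ∧
    (∀ (Nf R : ℕ) (A : QCDLatticeObservable Nf R) (U : _root_.Literature.MathematicalPhysics.QuantumLattice.LGConfig 4 (Matrix.specialUnitaryGroup (Fin 3) ℂ)),
        (Kobs Nf R A).osAdjoint.F U = (Kobs Nf R A.osAdjoint).F U) ∧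
    (∀ (Nf R : ℕ) (A : QCDLatticeObservable Nf R) (S : ℕ) [NeZero S]
        (v : _root_.Literature.Probability.LatticeModels.Site 4)
        (U : GaugeConfig 4 S (Matrix.specialUnitaryGroup (Fin 3) ℂ)),
        (Kobs Nf R A).osAdjoint.onTorus S v U = (Kobs Nf R A.osAdjoint).onTorus S v U) ∧
    (∀ (Nf R : ℕ) (A : QCDLatticeObservable Nf R) (S : ℕ) [NeZero S] (K : FermiAlg Nf S → FermiAlg Nf S),
        IsGammaFiveConj K →
        ∀ (v : _root_.Literature.Probability.LatticeModels.Site 4)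
          (U : GaugeConfig 4 S (Matrix.specialUnitaryGroup (Fin 3) ℂ)),
          (Kobs Nf R A).onTorus S v U = K (A.onTorus S v U))

/-- Stub 1 statement — **reduction to flavour-homogeneous pairs** (weight decomposition under the flavour
torus + bilinearity of the connected correlator). LANDED (p150053). -/
def HomogeneousReductionStmt : Prop :=
  ∀ (Nf : ℕ) (sch : QCDScheme Nf) (Δ : ℝ),
    (∀ (R R' : ℕ) (A : QCDLatticeObservable Nf R) (B : QCDLatticeObservable Nf R')
        (qA qB : Fin Nf → ℤ), IsFlavourHomogeneous A qA → IsFlavourHomogeneous B qB →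
        PairClusters sch Δ A B) →
      sch.HasLatticeMassGap Δ

/-- Stub 2 statement — **threshold uniformisation of the neutral hypothesis** along an asymptotically scaling
scheme on the physical branch: pair-by-pair neutral clustering at rate `2Δ` ⇒ common-threshold neutral
clustering at rate `2Δ`.  MISSTATED as typed (gen-0 evidence); kept registered because the crux AS FILED needs it. -/
def NeutralUniformisationStmt : Prop :=
  ∀ (Nf : ℕ) (sch : QCDScheme Nf) (Δ : ℝ), 0 < Δ → 0 < betaCoeff₀ Nf → sch.HasAsymptoticScaling →
    (∀ fl : Fin Nf, ∀ᶠ k in atTop, -1 < sch.mq fl k) →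
      sch.HasNeutralLatticeMassGap (2 * Δ) → UniformNeutralGap sch (2 * Δ)

/-- Stub 3 statement — **charged half-spectrum**: the common-threshold neutral gap at `2Δ` forces rate-`Δ`
clustering of every homogeneous pair carrying charge.  Kernel-checked consequence (`chargedHalfSpectrum_of`) of
`SelectionRuleStmt` (LANDED) and `ConjugateHalfSpectrumStmt`. -/
def ChargedHalfSpectrumStmt : Prop :=
  ∀ (Nf : ℕ) (sch : QCDScheme Nf) (Δ : ℝ), 0 < Δ → 0 < betaCoeff₀ Nf → sch.HasAsymptoticScaling →
    (∀ fl : Fin Nf, ∀ᶠ k in atTop, -1 < sch.mq fl k) →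
      UniformNeutralGap sch (2 * Δ) →
        ∀ (R R' : ℕ) (A : QCDLatticeObservable Nf R) (B : QCDLatticeObservable Nf R')
          (qA qB : Fin Nf → ℤ), IsFlavourHomogeneous A qA → IsFlavourHomogeneous B qB →
          (qA ≠ 0 ∨ qB ≠ 0) → PairClusters sch Δ A B

/-- Stub 3a statement (v2) — **exact flavour selection rule** (`q_A + q_B ≠ 0` ⇒ the connected correlator
vanishes identically). LANDED (p148868). -/
def SelectionRuleStmt : Prop :=
  ∀ (Nf : ℕ) (sch : QCDScheme Nf) (Δ : ℝ) (R R' : ℕ) (A : QCDLatticeObservable Nf R)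
    (B : QCDLatticeObservable Nf R') (qA qB : Fin Nf → ℤ),
    IsFlavourHomogeneous A qA → IsFlavourHomogeneous B qB → qA + qB ≠ 0 → PairClusters sch Δ A B

/-- Stub 3b statement (v2) — **conjugate-pair half-spectrum** (the Haag–Lüscher theorem proper, isolated):
the common-threshold neutral gap at rate `2Δ` forces rate-`Δ` clustering of every pair of homogeneous
observables of OPPOSITE non-zero charges `(q, −q)`.  Since v3 the kernel-checked consequence
(`conjugateHalfSpectrum_of`) of the heavy corner, the transport, the composites and the light core. -/
def ConjugateHalfSpectrumStmt : Prop :=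
  ∀ (Nf : ℕ) (sch : QCDScheme Nf) (Δ : ℝ), 0 < Δ → 0 < betaCoeff₀ Nf → sch.HasAsymptoticScaling →
    (∀ fl : Fin Nf, ∀ᶠ k in atTop, -1 < sch.mq fl k) →
      UniformNeutralGap sch (2 * Δ) →
        ∀ (R R' : ℕ) (A : QCDLatticeObservable Nf R) (B : QCDLatticeObservable Nf R')
          (q : Fin Nf → ℤ), IsFlavourHomogeneous A q → IsFlavourHomogeneous B (-q) → q ≠ 0 →
          PairClusters sch Δ A B

/-- Stub T statement (v3) — **transport of the common-threshold neutral gap to every axis** (hypercubic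
symmetry of the honest functional; `axisPerm` preserves neutrality). -/
def TransportStmt : Prop :=
  ∀ (Nf : ℕ) (sch : QCDScheme Nf) (Δ' : ℝ) (k₀ : ℕ),
    UniformNeutralGapFrom sch Δ' k₀ → ∀ i : Fin 4, UniformNeutralGapAlongFrom sch Δ' k₀ i

/-- Stub D statement (v3) — **positivity of the Wilson determinant for positive bare masses**: on every torus,
for every `SU(3)` field, `det (diracMatrix U mq) > 0` when all `m_f > 0` (real by `γ₅`-hermiticity,
non-zero by the hopping bound, positive by continuity in the mass / hopping strength). -/
def DetPosStmt : Prop :=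
  ∀ (Nf S : ℕ) [NeZero S] (U : GaugeConfig 4 S (Matrix.specialUnitaryGroup (Fin 3) ℂ)) (mq : Fin Nf → ℝ),
    (∀ f, 0 < mq f) → 0 < ((diracMatrix U mq).det).re

/-- Stub P statement (v3) — **configuration-wise hopping bound for conjugate charged pairs**: for homogeneous
`A` (charge `q ≠ 0`, box `R`) and `B` (charge `−q`, box `R'`) and a mass floor `m₀ > 0` there is `K` such that on
every torus `2S+1` with `R + R' < S`, for all masses `m_f ≥ m₀`, every gauge field and every `n ≤ S`, the
fermionic integral of `A(0)·B(n e₀)` against the Boltzmann factor is at most `K (4/(m₀+4))^n` times the modulus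
of the fermionic partition function (Wick: every pattern carries a quark line across the time gap;
`norm_inv_diracMatrix_apply_le_of_le`). -/
def HeavyPathwiseStmt : Prop :=
  ∀ (Nf R R' : ℕ) (A : QCDLatticeObservable Nf R) (B : QCDLatticeObservable Nf R') (q : Fin Nf → ℤ)
    (m₀ : ℝ), 0 < m₀ → IsFlavourHomogeneous A q → IsFlavourHomogeneous B (-q) → q ≠ 0 →
    ∃ K : ℝ, ∀ (S : ℕ), R + R' < S → ∀ (mq : Fin Nf → ℝ), (∀ f, m₀ ≤ mq f) →
      ∀ (U : GaugeConfig 4 (2 * S + 1) (Matrix.specialUnitaryGroup (Fin 3) ℂ)) (n : ℕ), n ≤ S →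
        ‖fermiIntegral (A.onTorus (2 * S + 1) 0 U * B.onTorus (2 * S + 1) (Pi.single 0 (n : ℤ)) U *
            fermiBoltzmann U mq)‖ ≤
          K * (4 / (m₀ + 4)) ^ n * ‖fermiIntegral (fermiBoltzmann U mq)‖

/-- Stub H statement (v3) — **the heavy-mass corner of the conjugate half-spectrum**: in the heavy corner,
conjugate charged pairs cluster at every positive rate, given determinant positivity and the pathwise bound. -/
def HeavyStmt : Prop :=
  DetPosStmt → HeavyPathwiseStmt →
  ∀ (Nf : ℕ) (sch : QCDScheme Nf) (Δ : ℝ), 0 < Δ → HeavyCorner sch →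
    ∀ (R R' : ℕ) (A : QCDLatticeObservable Nf R) (B : QCDLatticeObservable Nf R')
      (q : Fin Nf → ℤ), IsFlavourHomogeneous A q → IsFlavourHomogeneous B (-q) → q ≠ 0 →
      PairClusters sch Δ A B

/-- Stub C statement (v3) — **existence of the split composites `A · τ_v B` as gauge-invariant local
observables**, with the expected placement on every torus and additive flavour charge. -/
def CompositeStmt : Prop :=
  ∀ (Nf R R' : ℕ) (A : QCDLatticeObservable Nf R) (B : QCDLatticeObservable Nf R')
    (v : _root_.Literature.Probability.LatticeModels.Site 4),
    ∃ (R'' : ℕ) (N : QCDLatticeObservable Nf R''),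
      (∀ (S : ℕ) (u : _root_.Literature.Probability.LatticeModels.Site 4)
          (U : GaugeConfig 4 (2 * S + 1) (Matrix.specialUnitaryGroup (Fin 3) ℂ)),
          N.onTorus (2 * S + 1) u U = A.onTorus (2 * S + 1) u U * B.onTorus (2 * S + 1) (u + v) U) ∧
      ∀ qA qB : Fin Nf → ℤ, IsFlavourHomogeneous A qA → IsFlavourHomogeneous B qB →
        IsFlavourHomogeneous N (qA + qB)

/-- Stub Θ statement (v4) — **the Osterwalder–Seiler reflection flips the flavour charge**: if `A` is
flavour-homogeneous of charge `q` then `ΘA = A.osAdjoint` is flavour-homogeneous of charge `−q` (`Θ` is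
antilinear and exchanges `ψ_f ↔ ψ̄_f γ₀` within each flavour, so it conjugates the torus character).  Hence
`A · τ_v ΘA` is NEUTRAL — the composite the crux's hypothesis is applied to in every proof of the light core. -/
def OsAdjointChargeStmt : Prop :=
  ∀ (Nf R : ℕ) (A : QCDLatticeObservable Nf R) (q : Fin Nf → ℤ),
    IsFlavourHomogeneous A q → IsFlavourHomogeneous A.osAdjoint (-q)

/-- Stub G statement (v4) — **graded commutativity of torus placements of homogeneous observables**: a
flavour-homogeneous observable of charge `q` has Grassmann parity `∑_f q_f (mod 2)` (apply the torus element
`t ≡ −1`), `onTorus` preserves parity, and the torus Grassmann algebra is supercommutative; so the placed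
observables satisfy `A(u) B(v) = (−1)^{|q_A| |q_B|} B(v) A(u)` on every torus, at all positions, for every
gauge field (the regrouping of Euclidean 4-point functions between time grouping and space grouping). -/
def SupercommuteStmt : Prop :=
  ∀ (Nf R R' : ℕ) (A : QCDLatticeObservable Nf R) (B : QCDLatticeObservable Nf R')
    (qA qB : Fin Nf → ℤ), IsFlavourHomogeneous A qA → IsFlavourHomogeneous B qB →
    ∀ (S : ℕ) [NeZero S] (u v : _root_.Literature.Probability.LatticeModels.Site 4)
      (U : GaugeConfig 4 S (Matrix.specialUnitaryGroup (Fin 3) ℂ)),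
      A.onTorus S u U * B.onTorus S v U =
        ((-1 : ℂ) ^ ((∑ f, qA f) * (∑ f, qB f)).natAbs) • (B.onTorus S v U * A.onTorus S u U)

/-- Stub E1 statement (v5) — **the torus four-point regrouping identity** (Haag's splitting identity on the
statement's tori): for placements `A(0) B(v) A'(w) B'(w+v)` with `B`, `A'` flavour-homogeneous, and composites
`M = A·τ_v B`, `M' = A'·τ_v B'` (time split), `N = A·τ_w A'`, `N' = B·τ_w B'` (space split) given by their
placement identities (stub C), on every odd torus
`⟨M(0) M'(w)⟩ = (−1)^{|q_B||q_{A'}|} ⟨N(0) N'(v)⟩`, `⟨M'(w)⟩ = ⟨A'(0) B'(v)⟩`, `⟨N'(v)⟩ = ⟨B(0) B'(w)⟩`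
(graded commutativity of placements, stub G, and translation invariance of the honest functional). -/
def FourPointRegroupStmt : Prop :=
  ∀ (Nf RA RB RA' RB' RM RM' RN RN' : ℕ) (A : QCDLatticeObservable Nf RA) (B : QCDLatticeObservable Nf RB)
    (A' : QCDLatticeObservable Nf RA') (B' : QCDLatticeObservable Nf RB')
    (M : QCDLatticeObservable Nf RM) (M' : QCDLatticeObservable Nf RM')
    (N : QCDLatticeObservable Nf RN) (N' : QCDLatticeObservable Nf RN')
    (qB qA' : Fin Nf → ℤ) (v w : _root_.Literature.Probability.LatticeModels.Site 4),
    IsFlavourHomogeneous B qB → IsFlavourHomogeneous A' qA' →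
    (∀ (S : ℕ) (u : _root_.Literature.Probability.LatticeModels.Site 4)
        (U : GaugeConfig 4 (2 * S + 1) (Matrix.specialUnitaryGroup (Fin 3) ℂ)),
        M.onTorus (2 * S + 1) u U = A.onTorus (2 * S + 1) u U * B.onTorus (2 * S + 1) (u + v) U) →
    (∀ (S : ℕ) (u : _root_.Literature.Probability.LatticeModels.Site 4)
        (U : GaugeConfig 4 (2 * S + 1) (Matrix.specialUnitaryGroup (Fin 3) ℂ)),
        M'.onTorus (2 * S + 1) u U = A'.onTorus (2 * S + 1) u U * B'.onTorus (2 * S + 1) (u + v) U) →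
    (∀ (S : ℕ) (u : _root_.Literature.Probability.LatticeModels.Site 4)
        (U : GaugeConfig 4 (2 * S + 1) (Matrix.specialUnitaryGroup (Fin 3) ℂ)),
        N.onTorus (2 * S + 1) u U = A.onTorus (2 * S + 1) u U * A'.onTorus (2 * S + 1) (u + w) U) →
    (∀ (S : ℕ) (u : _root_.Literature.Probability.LatticeModels.Site 4)
        (U : GaugeConfig 4 (2 * S + 1) (Matrix.specialUnitaryGroup (Fin 3) ℂ)),
        N'.onTorus (2 * S + 1) u U = B.onTorus (2 * S + 1) u U * B'.onTorus (2 * S + 1) (u + w) U) →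
    ∀ (β : ℝ) (S : ℕ) (mq : Fin Nf → ℝ),
      qcdTorusExpect β (2 * S + 1) mq
            (fun U => M.onTorus (2 * S + 1) 0 U * M'.onTorus (2 * S + 1) w U) =
          (-1 : ℂ) ^ ((∑ f, qB f) * (∑ f, qA' f)).natAbs *
            qcdTorusExpect β (2 * S + 1) mq
              (fun U => N.onTorus (2 * S + 1) 0 U * N'.onTorus (2 * S + 1) v U) ∧
        qcdTorusExpect β (2 * S + 1) mq (M'.onTorus (2 * S + 1) w) =
          qcdTorusExpect β (2 * S + 1) mq
            (fun U => A'.onTorus (2 * S + 1) 0 U * B'.onTorus (2 * S + 1) v U) ∧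
        qcdTorusExpect β (2 * S + 1) mq (N'.onTorus (2 * S + 1) v) =
          qcdTorusExpect β (2 * S + 1) mq
            (fun U => B.onTorus (2 * S + 1) 0 U * B'.onTorus (2 * S + 1) w U)

/-- Stub E2 statement (v5) — **charged hypercubic transport**: for every pair `A, B` and every spatial axis `i`
there are observables `A₁, B₁` with the same quark boxes and the SAME flavour charges whose time-axis pair
correlator (and one-point functions) on every torus equal those of `A, B` along the axis `i` (axis permutation
`(0 i)` with its spinor intertwiner; `flavourScale` commutes with `boxAxisPerm`).  In Haag's identity at spatial
distance `S` the long-range-order term is thereby the antipodal temporal charged correlator. -/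
def ChargedTransportStmt : Prop :=
  ∀ (Nf R R' : ℕ) (A : QCDLatticeObservable Nf R) (B : QCDLatticeObservable Nf R') (i : Fin 4), i ≠ 0 →
    ∃ (A₁ : QCDLatticeObservable Nf R) (B₁ : QCDLatticeObservable Nf R'),
      (∀ q : Fin Nf → ℤ, IsFlavourHomogeneous A q → IsFlavourHomogeneous A₁ q) ∧
      (∀ q : Fin Nf → ℤ, IsFlavourHomogeneous B q → IsFlavourHomogeneous B₁ q) ∧
      ∀ (β : ℝ) (S : ℕ) [NeZero S] (mq : Fin Nf → ℝ) (n : ℤ),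
        qcdTorusExpect β S mq (fun U => A.onTorus S 0 U * B.onTorus S (Pi.single i n) U) =
            qcdTorusExpect β S mq (fun U => A₁.onTorus S 0 U * B₁.onTorus S (Pi.single 0 n) U) ∧
          qcdTorusExpect β S mq (A.onTorus S 0) = qcdTorusExpect β S mq (A₁.onTorus S 0) ∧
          qcdTorusExpect β S mq (B.onTorus S (Pi.single i n)) =
            qcdTorusExpect β S mq (B₁.onTorus S (Pi.single 0 n))

/-- Stub E4 statement (v5) — **Haag's product bound, transfer-operator form** (the operator half of the
half-spectrum lemma, Haag 1996 Thm II.5.4.1 read on a positive transfer matrix): for transfer data `(T, Ω)` on a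
Hilbert space, vectors `v, v'` and a sequence of (neutral) vectors `w_j` such that each `w_j` clusters at rate `r²`
EVENTUALLY with ITS OWN constant, `‖w_j‖ ≤ M`, `⟪Ω, w_j⟫ → 0` (no long-range order) and
`⟪w_j, Tⁿ w_j⟫ − ⟪v, Tⁿ v⟫⟪v', Tⁿ v'⟫ → 0` for each `n` (splitting), one has
`re⟪v, Tⁿ v⟫ · re⟪v', Tⁿ v'⟫ ≤ M² r^{2n}` for EVERY `n` — constants and thresholds of the neutral bounds are
washed out by the decay upgrade (`TransferDecayUpgrade`), only the norm bound survives. -/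
def HaagProductBoundStmt : Prop :=
  ∀ (H : Type) [NormedAddCommGroup H] [InnerProductSpace ℂ H] [CompleteSpace H]
    (D : _root_.Literature.Probability.LatticeModels.TransferData H) (v v' : H) (w : ℕ → H) (r M : ℝ),
    0 < r →
    (∀ j : ℕ, ∃ K : ℝ, ∀ᶠ n : ℕ in atTop,
        ‖inner ℂ (w j) ((D.T ^ n) (w j)) - inner ℂ (w j) D.vacuum * inner ℂ D.vacuum (w j)‖ ≤
          K * (r ^ 2) ^ n) →
    (∀ j : ℕ, ‖w j‖ ≤ M) →
    Tendsto (fun j : ℕ => inner ℂ D.vacuum (w j)) atTop (nhds 0) →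
    (∀ n : ℕ, Tendsto (fun j : ℕ => inner ℂ (w j) ((D.T ^ n) (w j)) -
        inner ℂ v ((D.T ^ n) v) * inner ℂ v' ((D.T ^ n) v')) atTop (nhds 0)) →
    ∀ n : ℕ, RCLike.re (inner ℂ v ((D.T ^ n) v)) * RCLike.re (inner ℂ v' ((D.T ^ n) v')) ≤
      M ^ 2 * (r ^ 2) ^ n

/-- Stub L statement (v6; held by the lead; crux-sized) — **the SPECTRAL light-mass core of the conjugate
half-spectrum**: outside the heavy corner, along an asymptotically scaling scheme on the physical branch, the
common-threshold neutral gap at `2Δ` ALONG EVERY AXIS, the split composites, the charge flip under `Θ`,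
graded commutativity of placements, the four-point regrouping (E1), the charged transport (E2), Haag's
product bound (E4) and (v6) the `γ₅`-conjugation symmetry (K0, K1, K1', K2: the charge-conjugation partner of
equal RP-diagonal correlator) force rate-`Δ` clustering of conjugate charged pairs (what remains: operator
dictionary with quark insertions on the reflection-positive family, uniform neutral bound for the `S`-dependent
composites, no charged long-range order, symmetric-torus return). -/
def LightCoreStmt : Prop :=
  OsAdjointChargeStmt → SupercommuteStmt → FourPointRegroupStmt → ChargedTransportStmt →
  HaagProductBoundStmt →
  ConjugationExistsStmt → ConjugationExpectStmt → ConjugationExpectAPStmt → ConjugationObservableStmt →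
  ∀ (Nf : ℕ) (sch : QCDScheme Nf) (Δ : ℝ), 0 < Δ → 0 < betaCoeff₀ Nf → sch.HasAsymptoticScaling →
    (∀ fl : Fin Nf, ∀ᶠ k in atTop, -1 < sch.mq fl k) → ¬ HeavyCorner sch →
      (∃ k₀ : ℕ, ∀ i : Fin 4, UniformNeutralGapAlongFrom sch (2 * Δ) k₀ i) →
        CompositeStmt →
          ∀ (R R' : ℕ) (A : QCDLatticeObservable Nf R) (B : QCDLatticeObservable Nf R')
            (q : Fin Nf → ℤ), IsFlavourHomogeneous A q → IsFlavourHomogeneous B (-q) → q ≠ 0 →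
            PairClusters sch Δ A B

/-! ## §2 Registered stubs

Every registered stub carries a SELF-CONTAINED signature — the §1 statement with the §0 currency unfolded, over
tree vocabulary only — so that a stub-worker can state and land it verbatim in a `Theorems/` file (which cannot
import this workfile); the bridges `…_stmt` below recover the §1 names by definitional unfolding. -/

/-- **Stub 1 — LANDED** (p150053, `…Birth.HomogeneousReduction.stub_homogeneous_reduction`): reduction to
flavour-homogeneous pairs (= `HomogeneousReductionStmt` unfolded). -/
theorem stub_homogeneous_reduction :
    ∀ (Nf : ℕ) (sch : QCDScheme Nf) (Δ : ℝ),
      (∀ (R R' : ℕ) (A : QCDLatticeObservable Nf R) (B : QCDLatticeObservable Nf R')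
          (qA qB : Fin Nf → ℤ),
          (∀ t : Fin Nf → ℂ, (∀ f, t f ≠ 0) → ∀ U,
              QCDLatticeObservable.flavourScale t (A.F U) = (∏ f, t f ^ (qA f)) • A.F U) →
          (∀ t : Fin Nf → ℂ, (∀ f, t f ≠ 0) → ∀ U,
              QCDLatticeObservable.flavourScale t (B.F U) = (∏ f, t f ^ (qB f)) • B.F U) →
          ∃ C : ℝ, ∀ᶠ k in atTop, ∀ S : ℕ, sch.L k ≤ S → ∀ n : ℕ, n ≤ S →
            ‖qcdLatticeConnectedCorr (sch.β k) (2 * S + 1) (fun fl => sch.mq fl k) A B n‖ ≤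
              C * Real.exp (-(Δ * (sch.a k * n)))) →
        sch.HasLatticeMassGap Δ :=
  HomogeneousReduction.stub_homogeneous_reduction

/-- **Stub 2 (size L; the crux's recorded weak point; MISSTATED as typed): threshold uniformisation**
(= `NeutralUniformisationStmt` unfolded).  As TYPED the hypothesis allows a light neutral state at every `k`
seen only by operators whose own threshold lies beyond `k` — nothing in `HasNeutralLatticeMassGap` is uniform
over pairs (gen-0 kernel-checked counter-model of the quantifier shape; Baire uniformises only per fixed
(box, link-support) Banach class).  Repair: the common threshold written into the crux's hypothesis (route
repair); under it this stub is the identity. -/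
theorem stub_neutral_threshold_uniformisation :
    ∀ (Nf : ℕ) (sch : QCDScheme Nf) (Δ : ℝ), 0 < Δ → 0 < betaCoeff₀ Nf → sch.HasAsymptoticScaling →
      (∀ fl : Fin Nf, ∀ᶠ k in atTop, -1 < sch.mq fl k) →
        sch.HasNeutralLatticeMassGap (2 * Δ) →
          ∃ k₀ : ℕ, ∀ (R R' : ℕ) (A : QCDLatticeObservable Nf R) (B : QCDLatticeObservable Nf R'),
            A.IsFlavourNeutral → B.IsFlavourNeutral → ∃ C : ℝ, ∀ k : ℕ, k₀ ≤ k →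
              ∀ S : ℕ, sch.L k ≤ S → ∀ n : ℕ, n ≤ S →
                ‖qcdLatticeConnectedCorr (sch.β k) (2 * S + 1) (fun fl => sch.mq fl k) A B n‖ ≤
                  C * Real.exp (-(2 * Δ * (sch.a k * n))) := by
  sorry

/-- **Stub 3a (v2) — LANDED** (p148868, `…Birth.SelectionRule.stub_selection_rule`): the exact flavour
selection rule (= `SelectionRuleStmt` unfolded). -/
theorem stub_selection_rule :
    ∀ (Nf : ℕ) (sch : QCDScheme Nf) (Δ : ℝ) (R R' : ℕ) (A : QCDLatticeObservable Nf R)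
      (B : QCDLatticeObservable Nf R') (qA qB : Fin Nf → ℤ),
      (∀ t : Fin Nf → ℂ, (∀ f, t f ≠ 0) → ∀ U,
          QCDLatticeObservable.flavourScale t (A.F U) = (∏ f, t f ^ (qA f)) • A.F U) →
      (∀ t : Fin Nf → ℂ, (∀ f, t f ≠ 0) → ∀ U,
          QCDLatticeObservable.flavourScale t (B.F U) = (∏ f, t f ^ (qB f)) • B.F U) →
      qA + qB ≠ 0 →
        ∃ C : ℝ, ∀ᶠ k in atTop, ∀ S : ℕ, sch.L k ≤ S → ∀ n : ℕ, n ≤ S →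
          ‖qcdLatticeConnectedCorr (sch.β k) (2 * S + 1) (fun fl => sch.mq fl k) A B n‖ ≤
            C * Real.exp (-(Δ * (sch.a k * n))) :=
  SelectionRule.stub_selection_rule

/-- **LANDED (p154207, `…Birth.NeutralGapAlongAxes.stub_neutral_gap_along_axes`).** **Stub T (v3; size M): the common-threshold neutral gap holds along every axis** (= `TransportStmt`
unfolded).  Apply the time-axis clause to the permuted pair `(A.axisPerm π S S', B.axisPerm π S S')` for the
transposition `π = (0 i)` with its spinor intertwiner (`transpositionSpinor_intertwines`) — both again NEUTRAL
because `boxAxisPerm` permutes sites and mixes spins within a fixed flavour and generator type, so it commutes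
with `flavourScale t` — and transport by `qcdTorusExpect_axisPerm_onTorus(_mul)`, `sitePermZd_single`,
exactly as in `QCDScheme.HasLatticeMassGap.along_axis`. -/
theorem stub_neutral_gap_along_axes :
    ∀ (Nf : ℕ) (sch : QCDScheme Nf) (Δ' : ℝ) (k₀ : ℕ),
      (∀ (R R' : ℕ) (A : QCDLatticeObservable Nf R) (B : QCDLatticeObservable Nf R'),
          A.IsFlavourNeutral → B.IsFlavourNeutral → ∃ C : ℝ, ∀ k : ℕ, k₀ ≤ k →
            ∀ S : ℕ, sch.L k ≤ S → ∀ n : ℕ, n ≤ S →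
              ‖qcdLatticeConnectedCorr (sch.β k) (2 * S + 1) (fun fl => sch.mq fl k) A B n‖ ≤
                C * Real.exp (-(Δ' * (sch.a k * n)))) →
      ∀ (i : Fin 4) (R R' : ℕ) (A : QCDLatticeObservable Nf R) (B : QCDLatticeObservable Nf R'),
        A.IsFlavourNeutral → B.IsFlavourNeutral → ∃ C : ℝ, ∀ k : ℕ, k₀ ≤ k →
          ∀ S : ℕ, sch.L k ≤ S → ∀ n : ℕ, n ≤ S →
            ‖qcdTorusExpect (sch.β k) (2 * S + 1) (fun fl => sch.mq fl k)
                  (fun U => A.onTorus (2 * S + 1) 0 U *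
                    B.onTorus (2 * S + 1) (Pi.single i (n : ℤ)) U) -
                qcdTorusExpect (sch.β k) (2 * S + 1) (fun fl => sch.mq fl k) (A.onTorus (2 * S + 1) 0) *
                  qcdTorusExpect (sch.β k) (2 * S + 1) (fun fl => sch.mq fl k)
                    (B.onTorus (2 * S + 1) (Pi.single i (n : ℤ)))‖ ≤
              C * Real.exp (-(Δ' * (sch.a k * n))) :=
  NeutralGapAlongAxes.stub_neutral_gap_along_axes

/-- **LANDED (p154547, `…Birth.DetDiracMatrixPos.stub_det_diracMatrix_pos`).** **Stub D (v3; size M): `det D(U) > 0` for positive bare masses** (= `DetPosStmt`).  `det D` is real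
(`det_diracMatrix_im`, `γ₅`-hermiticity) and factorises over flavours (`det_diracMatrix`); for one flavour
`det D_W(m) ≠ 0` for all `m > 0` (`wilsonDirac_det_ne_zero_of_pos`), is continuous in `m`, and is positive for
`m` large (`D_W = (m+4)(1 − x)`, `‖x‖ ≤ 4/(m+4)` by `norm_one_sub_smul_wilsonDirac_le`, continuity of `det` at
`1`), so it is positive on `(0, ∞)` by the intermediate value theorem (pattern: `det_thermalDiracCore_re_pos`
of `QCDThermalDeterminant.lean`, homotopy in the hopping strength). -/
theorem stub_det_diracMatrix_pos :
    ∀ (Nf S : ℕ) [NeZero S] (U : GaugeConfig 4 S (Matrix.specialUnitaryGroup (Fin 3) ℂ))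
      (mq : Fin Nf → ℝ), (∀ f, 0 < mq f) → 0 < ((diracMatrix U mq).det).re :=
  DetDiracMatrixPos.stub_det_diracMatrix_pos

/-- **LANDED (p155291, `…Birth.ConjugateHeavyPathwise.stub_conjugate_heavy_pathwise`).** **Stub P (v3; size L): configuration-wise hopping bound for conjugate charged pairs**
(= `HeavyPathwiseStmt` unfolded).  Expand `A.onTorus … U` and `B.onTorus … U` in the torus Grassmann monomial
basis (coefficients bounded uniformly in `U` by `A.bounded`/`B.bounded` through `exists_berezin_mul_eq_coord`;
every monomial of `A.onTorus` has flavour charge `q` and every monomial of `B.onTorus` charge `−q`, by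
`fermiFlavourScale_onTorus_of_homogeneous` and the diagonal action of `fermiFlavourScale` on the basis); each
product of two monomials is a four-block word, whose Gaussian Berezin integral is `det D ·` a minor of `D⁻¹`
(`berezin_grassmannExp_quadratic_mul_fourBlock`, `norm_berezin_fourBlock_mul_grassmannExp_div_le`,
`mul_grassmannExp_quadratic_comm`; unequal numbers of `ψ̄`/`ψ` give `0`); in the Leibniz expansion of the minor a
permutation with non-zero product preserves flavour (`inv_diracMatrix_apply_eq_zero_of_fst_ne`), hence — since
`q_f ≠ 0` for some `f` — pairs some variable of `A`'s box with one of `B`'s box, at cyclic time distance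
`≥ n − R − R'`; that factor is `≤ m₀⁻¹ (4/(m₀+4))^{n−R−R'}` and every other factor `≤ m₀⁻¹`
(`norm_inv_diracMatrix_apply_le_of_le` with `i = 0`). -/
theorem stub_conjugate_heavy_pathwise :
    ∀ (Nf R R' : ℕ) (A : QCDLatticeObservable Nf R) (B : QCDLatticeObservable Nf R') (q : Fin Nf → ℤ)
      (m₀ : ℝ), 0 < m₀ →
      (∀ t : Fin Nf → ℂ, (∀ f, t f ≠ 0) → ∀ U,
          QCDLatticeObservable.flavourScale t (A.F U) = (∏ f, t f ^ (q f)) • A.F U) →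
      (∀ t : Fin Nf → ℂ, (∀ f, t f ≠ 0) → ∀ U,
          QCDLatticeObservable.flavourScale t (B.F U) = (∏ f, t f ^ ((-q) f)) • B.F U) →
      q ≠ 0 →
        ∃ K : ℝ, ∀ (S : ℕ), R + R' < S → ∀ (mq : Fin Nf → ℝ), (∀ f, m₀ ≤ mq f) →
          ∀ (U : GaugeConfig 4 (2 * S + 1) (Matrix.specialUnitaryGroup (Fin 3) ℂ)) (n : ℕ), n ≤ S →
            ‖fermiIntegral (A.onTorus (2 * S + 1) 0 U * B.onTorus (2 * S + 1) (Pi.single 0 (n : ℤ)) U *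
                fermiBoltzmann U mq)‖ ≤
              K * (4 / (m₀ + 4)) ^ n * ‖fermiIntegral (fermiBoltzmann U mq)‖ :=
  ConjugateHeavyPathwise.stub_conjugate_heavy_pathwise

/-- **LANDED (p155839, `…Birth.ConjugateHeavy.stub_conjugate_heavy`).** **Stub H (v3; size M): the heavy-mass corner** (= `HeavyStmt` unfolded): given determinant positivity
(stub D) and the pathwise bound (stub P), in the heavy corner `m_f(k) ≥ m₀ > 0` eventually every conjugate charged
pair clusters at every rate `Δ > 0`.  `⟨A⟩ = ⟨B⟩ = 0` (`SelectionRule.qcdTorusExpect_onTorus_eq_zero`, `q ≠ 0`),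
so the connected correlator is the ratio `∫_U ∫dψ̄dψ A(0)B(n)e^{−ψ̄Dψ} / ∫_U ∫dψ̄dψ e^{−ψ̄Dψ}`; the denominator's
integrand `∫dψ̄dψ e^{−ψ̄D_Uψ} = ± det(−D_U)` (`berezin_grassmannExp_quadratic_holds`) has constant phase in `U`
by stub D, so `‖∫_U num‖ ≤ ∫_U ‖num‖ ≤ K θⁿ ∫_U ‖den‖ = K θⁿ ‖∫_U den‖` (`norm_integral_le_integral_norm`,
`integral_mono_of_nonneg`, continuity of `det ∘ diracMatrix` for integrability), `θ = 4/(m₀+4) < 1`; finally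
`θⁿ ≤ e^{−Δ a_k n}` as soon as `Δ a_k ≤ log θ⁻¹` (`sch.tendsto_a`), and `R + R' < L_k ≤ S` eventually
(`sch.tendsto_L` with `a_k → 0`). -/
theorem stub_conjugate_heavy :
    (∀ (Nf S : ℕ) [NeZero S] (U : GaugeConfig 4 S (Matrix.specialUnitaryGroup (Fin 3) ℂ))
        (mq : Fin Nf → ℝ), (∀ f, 0 < mq f) → 0 < ((diracMatrix U mq).det).re) →
    (∀ (Nf R R' : ℕ) (A : QCDLatticeObservable Nf R) (B : QCDLatticeObservable Nf R') (q : Fin Nf → ℤ)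
        (m₀ : ℝ), 0 < m₀ →
        (∀ t : Fin Nf → ℂ, (∀ f, t f ≠ 0) → ∀ U,
            QCDLatticeObservable.flavourScale t (A.F U) = (∏ f, t f ^ (q f)) • A.F U) →
        (∀ t : Fin Nf → ℂ, (∀ f, t f ≠ 0) → ∀ U,
            QCDLatticeObservable.flavourScale t (B.F U) = (∏ f, t f ^ ((-q) f)) • B.F U) →
        q ≠ 0 →
          ∃ K : ℝ, ∀ (S : ℕ), R + R' < S → ∀ (mq : Fin Nf → ℝ), (∀ f, m₀ ≤ mq f) →
            ∀ (U : GaugeConfig 4 (2 * S + 1) (Matrix.specialUnitaryGroup (Fin 3) ℂ)) (n : ℕ), n ≤ S →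
              ‖fermiIntegral (A.onTorus (2 * S + 1) 0 U * B.onTorus (2 * S + 1) (Pi.single 0 (n : ℤ)) U *
                  fermiBoltzmann U mq)‖ ≤
                K * (4 / (m₀ + 4)) ^ n * ‖fermiIntegral (fermiBoltzmann U mq)‖) →
    ∀ (Nf : ℕ) (sch : QCDScheme Nf) (Δ : ℝ), 0 < Δ →
      (∃ m₀ : ℝ, 0 < m₀ ∧ ∀ fl : Fin Nf, ∀ᶠ k in atTop, m₀ ≤ sch.mq fl k) →
        ∀ (R R' : ℕ) (A : QCDLatticeObservable Nf R) (B : QCDLatticeObservable Nf R')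
          (q : Fin Nf → ℤ),
          (∀ t : Fin Nf → ℂ, (∀ f, t f ≠ 0) → ∀ U,
              QCDLatticeObservable.flavourScale t (A.F U) = (∏ f, t f ^ (q f)) • A.F U) →
          (∀ t : Fin Nf → ℂ, (∀ f, t f ≠ 0) → ∀ U,
              QCDLatticeObservable.flavourScale t (B.F U) = (∏ f, t f ^ ((-q) f)) • B.F U) →
          q ≠ 0 →
            ∃ C : ℝ, ∀ᶠ k in atTop, ∀ S : ℕ, sch.L k ≤ S → ∀ n : ℕ, n ≤ S →
              ‖qcdLatticeConnectedCorr (sch.β k) (2 * S + 1) (fun fl => sch.mq fl k) A B n‖ ≤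
                C * Real.exp (-(Δ * (sch.a k * n))) :=
  ConjugateHeavy.stub_conjugate_heavy

/-- **LANDED (p156790, `…Birth.CompositeObservable.stub_composite_observable`).** **Stub C (v3; size M): the split composites exist** (= `CompositeStmt` unfolded).  For `R'' = R + R' + ‖v‖∞`
(any `R''` containing both boxes) take `N.F U = ι_A (A.F U) * ι_{B,v} (B.F (configShift (−v) U))`, where
`ι_A`, `ι_{B,v} : BoxFermiAlg → BoxFermiAlg` are the algebra maps induced by the box inclusions `x ↦ x`,
`x ↦ x + v` on generators (`ExteriorAlgebra.map` of the coefficient maps); cylinder, joint gauge invariance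
(`fermiGaugeAct` intertwines, cf. `fermiGaugeAct_boxAxisPerm`), bounded and measurable coefficients follow the
pattern of `QCDLatticeObservable.axisPerm` / `instMul` (`QCDObservableProduct`); the placement identity is
`ExteriorAlgebra.map_comp_map` + `toTorusIdx` bookkeeping + `configShift_add'`/`configShift_torusLift`
(`QCDTorusTranslation`), and charges add because `flavourScale t` is an algebra map commuting with both
inclusions. -/
theorem stub_composite_observable :
    ∀ (Nf R R' : ℕ) (A : QCDLatticeObservable Nf R) (B : QCDLatticeObservable Nf R')
      (v : _root_.Literature.Probability.LatticeModels.Site 4),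
      ∃ (R'' : ℕ) (N : QCDLatticeObservable Nf R''),
        (∀ (S : ℕ) (u : _root_.Literature.Probability.LatticeModels.Site 4)
            (U : GaugeConfig 4 (2 * S + 1) (Matrix.specialUnitaryGroup (Fin 3) ℂ)),
            N.onTorus (2 * S + 1) u U = A.onTorus (2 * S + 1) u U * B.onTorus (2 * S + 1) (u + v) U) ∧
        ∀ qA qB : Fin Nf → ℤ,
          (∀ t : Fin Nf → ℂ, (∀ f, t f ≠ 0) → ∀ U,
              QCDLatticeObservable.flavourScale t (A.F U) = (∏ f, t f ^ (qA f)) • A.F U) →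
          (∀ t : Fin Nf → ℂ, (∀ f, t f ≠ 0) → ∀ U,
              QCDLatticeObservable.flavourScale t (B.F U) = (∏ f, t f ^ (qB f)) • B.F U) →
          ∀ t : Fin Nf → ℂ, (∀ f, t f ≠ 0) → ∀ U,
              QCDLatticeObservable.flavourScale t (N.F U) = (∏ f, t f ^ ((qA + qB) f)) • N.F U :=
  CompositeObservable.stub_composite_observable

/-- **LANDED (p159504, `…Birth.OsAdjointCharge.stub_osAdjoint_charge`).** **Stub Θ (v4; size M): the OS reflection flips the flavour charge** (= `OsAdjointChargeStmt` unfolded).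
`A.osAdjoint.F U = fermiTheta (A.F (cfgReflect U))` with `fermiTheta = rev ∘ Λ(fermiThetaLin) ∘ conj`
(`fermiTheta_apply`); `flavourScale s = Λ(diag (flavourWeight s))`; the pattern of `fermiGaugeAct_fermiTheta`
(`reverse_map_eq`, `ExteriorAlgebra.map_comp_map`, `grassmannConj_map`) reduces
`flavourScale s ∘ fermiTheta = fermiTheta ∘ flavourScale (star s)⁻¹` to the linear identity
`flavourLin s ∘ fermiThetaLin = fermiThetaLin ∘ conjLin (flavourLin (star s)⁻¹)` (`fermiThetaLin` moves a
`ψ_f`-coefficient to a `ψ̄_f`-slot of the SAME flavour; `s_f⁻¹ = conj ((conj s_f)⁻¹)`, valid also at `s_f = 0`);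
then antilinearity turns the character `∏ ((star s)⁻¹)_f^{q_f}` into `∏ s_f^{−q_f}`. -/
theorem stub_osAdjoint_charge :
    ∀ (Nf R : ℕ) (A : QCDLatticeObservable Nf R) (q : Fin Nf → ℤ),
      (∀ t : Fin Nf → ℂ, (∀ f, t f ≠ 0) → ∀ U,
          QCDLatticeObservable.flavourScale t (A.F U) = (∏ f, t f ^ (q f)) • A.F U) →
      ∀ t : Fin Nf → ℂ, (∀ f, t f ≠ 0) → ∀ U,
          QCDLatticeObservable.flavourScale t (A.osAdjoint.F U) = (∏ f, t f ^ ((-q) f)) • A.osAdjoint.F U :=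
  OsAdjointCharge.stub_osAdjoint_charge

/-- **LANDED (p160350, `…Birth.Supercommute.stub_homogeneous_supercommute`).** **Stub G (v4; size M): graded commutativity of torus placements of homogeneous observables**
(= `SupercommuteStmt` unfolded).  Homogeneity at `t ≡ −1` gives `flavourScale (−1) (A.F U) = (−1)^{∑ q_f} A.F U`,
and `flavourScale (−1)` is the parity automorphism (`−1` on every generator), so `A.F U ∈ evenOdd (∑ q_f mod 2)`
(`GrassmannParity`: `eq_sum_filter_of_mem_evenOdd`, `grassmannBasis_mem_evenOdd`, `exteriorMap_diag_grassmannBasis`);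
`onTorus = Λ(linear map)` preserves parity (`map_mem_evenOdd_zero` and its odd twin); homogeneous-parity elements
of a Grassmann algebra supercommute (even ones are central, `commute_of_mem_evenOdd_zero`; two odd ones anticommute,
from `θ_s θ_t = (−1)^{|s||t|} θ_t θ_s` on the monomial basis). -/
theorem stub_homogeneous_supercommute :
    ∀ (Nf R R' : ℕ) (A : QCDLatticeObservable Nf R) (B : QCDLatticeObservable Nf R') (qA qB : Fin Nf → ℤ),
      (∀ t : Fin Nf → ℂ, (∀ f, t f ≠ 0) → ∀ U,
          QCDLatticeObservable.flavourScale t (A.F U) = (∏ f, t f ^ (qA f)) • A.F U) →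
      (∀ t : Fin Nf → ℂ, (∀ f, t f ≠ 0) → ∀ U,
          QCDLatticeObservable.flavourScale t (B.F U) = (∏ f, t f ^ (qB f)) • B.F U) →
      ∀ (S : ℕ) [NeZero S] (u v : _root_.Literature.Probability.LatticeModels.Site 4)
        (U : GaugeConfig 4 S (Matrix.specialUnitaryGroup (Fin 3) ℂ)),
        A.onTorus S u U * B.onTorus S v U =
          ((-1 : ℂ) ^ ((∑ f, qA f) * (∑ f, qB f)).natAbs) • (B.onTorus S v U * A.onTorus S u U) :=
  Supercommute.stub_homogeneous_supercommute

/-- **LANDED (p165317, `…Birth.FourPointRegroup.stub_fourPoint_regrouping`).** **Stub E1 (v5; size S/M): the torus four-point regrouping identity** (= `FourPointRegroupStmt` unfolded).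
`M(0)·M'(w) = A(0)·B(v)·A'(w)·B'(w+v)` by the placement identities and associativity; swapping the middle factors
costs `(−1)^{|q_B||q_{A'}|}` (`Supercommute.stub_homogeneous_supercommute`, p160350) and gives
`A(0)·A'(w)·B(v)·B'(v+w) = N(0)·N'(v)`; `qcdTorusExpect_smul` pulls the sign out; the one-point identities are
`qcdTorusExpect_onTorus_mul_onTorus_add` (translation by `w`, resp. `v`). -/
theorem stub_fourPoint_regrouping :
    ∀ (Nf RA RB RA' RB' RM RM' RN RN' : ℕ) (A : QCDLatticeObservable Nf RA) (B : QCDLatticeObservable Nf RB)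
      (A' : QCDLatticeObservable Nf RA') (B' : QCDLatticeObservable Nf RB')
      (M : QCDLatticeObservable Nf RM) (M' : QCDLatticeObservable Nf RM')
      (N : QCDLatticeObservable Nf RN) (N' : QCDLatticeObservable Nf RN')
      (qB qA' : Fin Nf → ℤ) (v w : _root_.Literature.Probability.LatticeModels.Site 4),
      (∀ t : Fin Nf → ℂ, (∀ f, t f ≠ 0) → ∀ U,
          QCDLatticeObservable.flavourScale t (B.F U) = (∏ f, t f ^ (qB f)) • B.F U) →
      (∀ t : Fin Nf → ℂ, (∀ f, t f ≠ 0) → ∀ U,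
          QCDLatticeObservable.flavourScale t (A'.F U) = (∏ f, t f ^ (qA' f)) • A'.F U) →
      (∀ (S : ℕ) (u : _root_.Literature.Probability.LatticeModels.Site 4)
          (U : GaugeConfig 4 (2 * S + 1) (Matrix.specialUnitaryGroup (Fin 3) ℂ)),
          M.onTorus (2 * S + 1) u U = A.onTorus (2 * S + 1) u U * B.onTorus (2 * S + 1) (u + v) U) →
      (∀ (S : ℕ) (u : _root_.Literature.Probability.LatticeModels.Site 4)
          (U : GaugeConfig 4 (2 * S + 1) (Matrix.specialUnitaryGroup (Fin 3) ℂ)),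
          M'.onTorus (2 * S + 1) u U = A'.onTorus (2 * S + 1) u U * B'.onTorus (2 * S + 1) (u + v) U) →
      (∀ (S : ℕ) (u : _root_.Literature.Probability.LatticeModels.Site 4)
          (U : GaugeConfig 4 (2 * S + 1) (Matrix.specialUnitaryGroup (Fin 3) ℂ)),
          N.onTorus (2 * S + 1) u U = A.onTorus (2 * S + 1) u U * A'.onTorus (2 * S + 1) (u + w) U) →
      (∀ (S : ℕ) (u : _root_.Literature.Probability.LatticeModels.Site 4)
          (U : GaugeConfig 4 (2 * S + 1) (Matrix.specialUnitaryGroup (Fin 3) ℂ)),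
          N'.onTorus (2 * S + 1) u U = B.onTorus (2 * S + 1) u U * B'.onTorus (2 * S + 1) (u + w) U) →
      ∀ (β : ℝ) (S : ℕ) (mq : Fin Nf → ℝ),
        qcdTorusExpect β (2 * S + 1) mq
              (fun U => M.onTorus (2 * S + 1) 0 U * M'.onTorus (2 * S + 1) w U) =
            (-1 : ℂ) ^ ((∑ f, qB f) * (∑ f, qA' f)).natAbs *
              qcdTorusExpect β (2 * S + 1) mq
                (fun U => N.onTorus (2 * S + 1) 0 U * N'.onTorus (2 * S + 1) v U) ∧
          qcdTorusExpect β (2 * S + 1) mq (M'.onTorus (2 * S + 1) w) =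
            qcdTorusExpect β (2 * S + 1) mq
              (fun U => A'.onTorus (2 * S + 1) 0 U * B'.onTorus (2 * S + 1) v U) ∧
          qcdTorusExpect β (2 * S + 1) mq (N'.onTorus (2 * S + 1) v) =
            qcdTorusExpect β (2 * S + 1) mq
              (fun U => B.onTorus (2 * S + 1) 0 U * B'.onTorus (2 * S + 1) w U) :=
  FourPointRegroup.stub_fourPoint_regrouping

/-- **LANDED (p165322, `…Birth.ChargedTransport.stub_charged_axis_transport`).** **Stub E2 (v5; size S/M): charged hypercubic transport** (= `ChargedTransportStmt` unfolded).  Witnesses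
`A₁ = A.axisPerm π Σ Σ'`, `B₁ = B.axisPerm π Σ Σ'` for `π = Equiv.swap 0 i` with the spinor intertwiner
`transpositionSpinor 0 i` / `transpositionSpinorInv 0 i` (`transpositionSpinor_intertwines`); homogeneity is
preserved because `flavourScale t` commutes with `boxAxisPerm` (`NeutralGapAlongAxes.flavourScale_boxAxisPerm`,
p154207, and `QCDLatticeObservable.axisPerm_F`); the expectation identities are
`qcdTorusExpect_axisPerm_onTorus(_mul)` with `sitePermZd_zero`, `sitePermZd_single` — the pattern of
`QCDScheme.HasLatticeMassGap.along_axis`. -/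
theorem stub_charged_axis_transport :
    ∀ (Nf R R' : ℕ) (A : QCDLatticeObservable Nf R) (B : QCDLatticeObservable Nf R') (i : Fin 4), i ≠ 0 →
      ∃ (A₁ : QCDLatticeObservable Nf R) (B₁ : QCDLatticeObservable Nf R'),
        (∀ q : Fin Nf → ℤ,
          (∀ t : Fin Nf → ℂ, (∀ f, t f ≠ 0) → ∀ U,
              QCDLatticeObservable.flavourScale t (A.F U) = (∏ f, t f ^ (q f)) • A.F U) →
          ∀ t : Fin Nf → ℂ, (∀ f, t f ≠ 0) → ∀ U,
              QCDLatticeObservable.flavourScale t (A₁.F U) = (∏ f, t f ^ (q f)) • A₁.F U) ∧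
        (∀ q : Fin Nf → ℤ,
          (∀ t : Fin Nf → ℂ, (∀ f, t f ≠ 0) → ∀ U,
              QCDLatticeObservable.flavourScale t (B.F U) = (∏ f, t f ^ (q f)) • B.F U) →
          ∀ t : Fin Nf → ℂ, (∀ f, t f ≠ 0) → ∀ U,
              QCDLatticeObservable.flavourScale t (B₁.F U) = (∏ f, t f ^ (q f)) • B₁.F U) ∧
        ∀ (β : ℝ) (S : ℕ) [NeZero S] (mq : Fin Nf → ℝ) (n : ℤ),
          qcdTorusExpect β S mq (fun U => A.onTorus S 0 U * B.onTorus S (Pi.single i n) U) =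
              qcdTorusExpect β S mq (fun U => A₁.onTorus S 0 U * B₁.onTorus S (Pi.single 0 n) U) ∧
            qcdTorusExpect β S mq (A.onTorus S 0) = qcdTorusExpect β S mq (A₁.onTorus S 0) ∧
            qcdTorusExpect β S mq (B.onTorus S (Pi.single i n)) =
              qcdTorusExpect β S mq (B₁.onTorus S (Pi.single 0 n)) :=
  ChargedTransport.stub_charged_axis_transport

/-- **LANDED (p165343, `…Birth.HaagProductBound.stub_haag_product_bound`).** **Stub E4 (v5; size M): Haag's product bound, transfer-operator form** (= `HaagProductBoundStmt`).  For each
`j`, `TransferData.re_inner_pow_sub_le_truncNorm_mul_pow_of_eventually` (the decay upgrade at rate `r²`) gives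
`re⟪w_j, Tⁿ w_j⟫ ≤ ‖w_j‖² (r²)ⁿ + ‖⟪Ω, w_j⟫‖² ≤ M² (r²)ⁿ + ‖⟪Ω, w_j⟫‖²` for EVERY `n`; let `j → ∞` using the
splitting and the no-LRO hypotheses (`le_of_tendsto`); finally `⟪v, Tⁿ v⟫`, `⟪v', Tⁿ v'⟫` are real
(`TransferData.isPositive_pow`, symmetry), so the real part of the product is the product of the real parts. -/
theorem stub_haag_product_bound :
    ∀ (H : Type) [NormedAddCommGroup H] [InnerProductSpace ℂ H] [CompleteSpace H]
      (D : _root_.Literature.Probability.LatticeModels.TransferData H) (v v' : H) (w : ℕ → H) (r M : ℝ),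
      0 < r →
      (∀ j : ℕ, ∃ K : ℝ, ∀ᶠ n : ℕ in atTop,
          ‖inner ℂ (w j) ((D.T ^ n) (w j)) - inner ℂ (w j) D.vacuum * inner ℂ D.vacuum (w j)‖ ≤
            K * (r ^ 2) ^ n) →
      (∀ j : ℕ, ‖w j‖ ≤ M) →
      Tendsto (fun j : ℕ => inner ℂ D.vacuum (w j)) atTop (nhds 0) →
      (∀ n : ℕ, Tendsto (fun j : ℕ => inner ℂ (w j) ((D.T ^ n) (w j)) -
          inner ℂ v ((D.T ^ n) v) * inner ℂ v' ((D.T ^ n) v')) atTop (nhds 0)) →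
      ∀ n : ℕ, RCLike.re (inner ℂ v ((D.T ^ n) v)) * RCLike.re (inner ℂ v' ((D.T ^ n) v')) ≤
        M ^ 2 * (r ^ 2) ^ n :=
  HaagProductBound.stub_haag_product_bound

/-- **LANDED (p172923, `…Birth.GammaFiveConjExists.stub_gammaFiveConj_exists`).** **Stub K0 (v6; size S): a `γ₅`-conjugation exists on every torus quark Grassmann algebra**
(= `ConjugationExistsStmt` unfolded).  Witness: the Literature `torusK = Λ(K₀) ∘ conj`
(`QCDGammaFiveConjugation.lean`, p172263): multiplicative (`torusK_mul`), additive, antilinear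
(`LinearMap.map_smulₛₗ`), unital (`torusK_one`), with the generator values read off `torusK_ι`/`torusKLin`
(pattern of `torusTheta_q`/`torusTheta_qbar`). -/
theorem stub_gammaFiveConj_exists :
    ∀ (Nf S : ℕ) [NeZero S], ∃ K : FermiAlg Nf S → FermiAlg Nf S,
      (∀ x y, K (x * y) = K x * K y) ∧ (∀ x y, K (x + y) = K x + K y) ∧
        (∀ (c : ℂ) (x : FermiAlg Nf S), K (c • x) = starRingEnd ℂ c • K x) ∧ K 1 = 1 ∧
        (∀ v : QuarkVar Nf S, K (_root_.Literature.MathematicalPhysics.QuantumFieldTheory.q v) =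
          -∑ σ : Fin 4, _root_.Literature.MathematicalPhysics.QuantumLattice.gammaFive σ v.2.2.2 •
            _root_.Literature.MathematicalPhysics.QuantumFieldTheory.qbar (v.1, (v.2.1, v.2.2.1, σ))) ∧
        (∀ v : QuarkVar Nf S, K (_root_.Literature.MathematicalPhysics.QuantumFieldTheory.qbar v) =
          ∑ σ : Fin 4, _root_.Literature.MathematicalPhysics.QuantumLattice.gammaFive v.2.2.2 σ •
            _root_.Literature.MathematicalPhysics.QuantumFieldTheory.q (v.1, (v.2.1, v.2.2.1, σ))) :=
  GammaFiveConjExists.stub_gammaFiveConj_exists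

/-- **LANDED (p173729 + helper p173354, `…Birth.GammaFiveConjExpect.stub_gammaFiveConj_expect`).** **Stub K1 (v6; size M): `γ₅`-conjugation symmetry of the statement's torus functional**
(= `ConjugationExpectStmt` unfolded).  Any `γ₅`-conjugation `K` agrees with `torusK` (uniqueness from the
characterisation, `ExteriorAlgebra.induction`); `torusK (ψ̄Aψ) = ψ̄ A^K ψ` with `A^K = kMatrix A` (one
anticommutation absorbs the sign of `K₀`; pattern of `torusTheta_quadratic` without the reversal),
`kMatrix (diracMatrix U m) = diracMatrix U m` is `γ₅`-hermiticity flavour by flavour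
(`wilsonDirac_gammaFive_hermitian_holds`), `torusK` of the exponential is the exponential
(`torusTheta_grassmannExp` pattern), `∫dψ̄dψ ∘ K = det K₀ · conj ∘ ∫dψ̄dψ` (`fermiIntegral_torusK`), and
`∫ conj = conj ∫` (`integral_conj`); the constant `det K₀` cancels in the ratio (if it vanished both sides
would be the junk `0`). -/
theorem stub_gammaFiveConj_expect :
    ∀ (Nf S : ℕ) [NeZero S] (K : FermiAlg Nf S → FermiAlg Nf S),
      ((∀ x y, K (x * y) = K x * K y) ∧ (∀ x y, K (x + y) = K x + K y) ∧
        (∀ (c : ℂ) (x : FermiAlg Nf S), K (c • x) = starRingEnd ℂ c • K x) ∧ K 1 = 1 ∧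
        (∀ v : QuarkVar Nf S, K (_root_.Literature.MathematicalPhysics.QuantumFieldTheory.q v) =
          -∑ σ : Fin 4, _root_.Literature.MathematicalPhysics.QuantumLattice.gammaFive σ v.2.2.2 •
            _root_.Literature.MathematicalPhysics.QuantumFieldTheory.qbar (v.1, (v.2.1, v.2.2.1, σ))) ∧
        (∀ v : QuarkVar Nf S, K (_root_.Literature.MathematicalPhysics.QuantumFieldTheory.qbar v) =
          ∑ σ : Fin 4, _root_.Literature.MathematicalPhysics.QuantumLattice.gammaFive v.2.2.2 σ •
            _root_.Literature.MathematicalPhysics.QuantumFieldTheory.q (v.1, (v.2.1, v.2.2.1, σ)))) →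
      (∀ (U : GaugeConfig 4 S (Matrix.specialUnitaryGroup (Fin 3) ℂ)) (mq : Fin Nf → ℝ),
          K (fermiBoltzmann U mq) = fermiBoltzmann U mq) ∧
        ∀ (β : ℝ) (mq : Fin Nf → ℝ)
          (X : GaugeConfig 4 S (Matrix.specialUnitaryGroup (Fin 3) ℂ) → FermiAlg Nf S),
          qcdTorusExpect β S mq (fun U => K (X U)) = starRingEnd ℂ (qcdTorusExpect β S mq X) :=
  GammaFiveConjExpect.stub_gammaFiveConj_expect

/-- **LANDED (p173948, `…Birth.GammaFiveConjExpectAP.stub_gammaFiveConj_expectAP`).** **Stub K1' (v6; size M): `γ₅`-conjugation symmetry of the time-antiperiodic torus functional**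
(= `ConjugationExpectAPStmt` unfolded): as K1 with `fermiBoltzmannAP`/`qcdTorusExpectAP`; the extra input is
`γ₅`-hermiticity of `diracMatrixAP` (`QCDTimeReflection.wilsonDiracAP`: the tree's `wilsonDirac` with REAL
boundary signs `apLinkSign` on one temporal layer — the forward term at `(p,q)` and the backward term at
`(q,p)` carry the same sign, so the proof of `wilsonDirac_gammaFive_hermitian_holds` goes through verbatim). -/
theorem stub_gammaFiveConj_expectAP :
    ∀ (Nf S : ℕ) [NeZero S] (K : FermiAlg Nf S → FermiAlg Nf S),
      ((∀ x y, K (x * y) = K x * K y) ∧ (∀ x y, K (x + y) = K x + K y) ∧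
        (∀ (c : ℂ) (x : FermiAlg Nf S), K (c • x) = starRingEnd ℂ c • K x) ∧ K 1 = 1 ∧
        (∀ v : QuarkVar Nf S, K (_root_.Literature.MathematicalPhysics.QuantumFieldTheory.q v) =
          -∑ σ : Fin 4, _root_.Literature.MathematicalPhysics.QuantumLattice.gammaFive σ v.2.2.2 •
            _root_.Literature.MathematicalPhysics.QuantumFieldTheory.qbar (v.1, (v.2.1, v.2.2.1, σ))) ∧
        (∀ v : QuarkVar Nf S, K (_root_.Literature.MathematicalPhysics.QuantumFieldTheory.qbar v) =
          ∑ σ : Fin 4, _root_.Literature.MathematicalPhysics.QuantumLattice.gammaFive v.2.2.2 σ •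
            _root_.Literature.MathematicalPhysics.QuantumFieldTheory.q (v.1, (v.2.1, v.2.2.1, σ)))) →
      (∀ (U : GaugeConfig 4 S (Matrix.specialUnitaryGroup (Fin 3) ℂ)) (mq : Fin Nf → ℝ),
          K (fermiBoltzmannAP U mq) = fermiBoltzmannAP U mq) ∧
        ∀ (β : ℝ) (mq : Fin Nf → ℝ)
          (X : GaugeConfig 4 S (Matrix.specialUnitaryGroup (Fin 3) ℂ) → FermiAlg Nf S),
          qcdTorusExpectAP β S mq (fun U => K (X U)) = starRingEnd ℂ (qcdTorusExpectAP β S mq X) :=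
  GammaFiveConjExpectAP.stub_gammaFiveConj_expectAP

/-- **LANDED (p174080, `…Birth.GammaFiveConjObservable.stub_gammaFiveConj_observable`).** **Stub K2 (v6; size M): the observable-level conjugation `A ↦ A^K`** (= `ConjugationObservableStmt`
unfolded).  Witness: the Literature `QCDLatticeObservable.kConj` (`(A^K)(U) = K(A(U))`, gauge invariant by
`fermiGaugeAct_fermiK`).  Charge flip: `flavourScale t ∘ K = K ∘ flavourScale ((t̄)⁻¹)` on the box algebra
(pattern of `OsAdjointCharge.flavourLin_comp_fermiThetaLin`, `conj_prod_star_inv_zpow`); `ΘK = KΘ`: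
`fermiThetaLin ∘ conjLin fermiKLin = fermiKLin ∘ conjLin fermiThetaLin` on generator coefficients
(`γ₅γ₀ = −γ₀γ₅`, `γ₀ᴴ = γ₀`, `γ₅` real diagonal) and `reverse_map_eq`; placement:
`placeLin S v ∘ fermiKLin = torusKLin ∘ placeLin S v` (the substitution does not move sites; pattern of
`placeLin_comp_fermiThetaLin`/`torusTheta_onTorus`), then uniqueness of `γ₅`-conjugations. -/
theorem stub_gammaFiveConj_observable :
    ∃ Kobs : ∀ (Nf R : ℕ), QCDLatticeObservable Nf R → QCDLatticeObservable Nf R,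
      (∀ (Nf R : ℕ) (A : QCDLatticeObservable Nf R) (qA : Fin Nf → ℤ),
          (∀ t : Fin Nf → ℂ, (∀ f, t f ≠ 0) → ∀ U,
              QCDLatticeObservable.flavourScale t (A.F U) = (∏ f, t f ^ (qA f)) • A.F U) →
          ∀ t : Fin Nf → ℂ, (∀ f, t f ≠ 0) → ∀ U,
              QCDLatticeObservable.flavourScale t ((Kobs Nf R A).F U) =
                (∏ f, t f ^ ((-qA) f)) • (Kobs Nf R A).F U) ∧
      (∀ (Nf R : ℕ) (A : QCDLatticeObservable Nf R) (U : _root_.Literature.MathematicalPhysics.QuantumLattice.LGConfig 4 (Matrix.specialUnitaryGroup (Fin 3) ℂ)),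
          (Kobs Nf R A).osAdjoint.F U = (Kobs Nf R A.osAdjoint).F U) ∧
      (∀ (Nf R : ℕ) (A : QCDLatticeObservable Nf R) (S : ℕ) [NeZero S]
          (v : _root_.Literature.Probability.LatticeModels.Site 4)
          (U : GaugeConfig 4 S (Matrix.specialUnitaryGroup (Fin 3) ℂ)),
          (Kobs Nf R A).osAdjoint.onTorus S v U = (Kobs Nf R A.osAdjoint).onTorus S v U) ∧
      (∀ (Nf R : ℕ) (A : QCDLatticeObservable Nf R) (S : ℕ) [NeZero S] (K : FermiAlg Nf S → FermiAlg Nf S),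
          ((∀ x y, K (x * y) = K x * K y) ∧ (∀ x y, K (x + y) = K x + K y) ∧
            (∀ (c : ℂ) (x : FermiAlg Nf S), K (c • x) = starRingEnd ℂ c • K x) ∧ K 1 = 1 ∧
            (∀ v : QuarkVar Nf S, K (_root_.Literature.MathematicalPhysics.QuantumFieldTheory.q v) =
              -∑ σ : Fin 4, _root_.Literature.MathematicalPhysics.QuantumLattice.gammaFive σ v.2.2.2 •
                _root_.Literature.MathematicalPhysics.QuantumFieldTheory.qbar (v.1, (v.2.1, v.2.2.1, σ))) ∧
            (∀ v : QuarkVar Nf S, K (_root_.Literature.MathematicalPhysics.QuantumFieldTheory.qbar v) =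
              ∑ σ : Fin 4, _root_.Literature.MathematicalPhysics.QuantumLattice.gammaFive v.2.2.2 σ •
                _root_.Literature.MathematicalPhysics.QuantumFieldTheory.q (v.1, (v.2.1, v.2.2.1, σ)))) →
          ∀ (v : _root_.Literature.Probability.LatticeModels.Site 4)
            (U : GaugeConfig 4 S (Matrix.specialUnitaryGroup (Fin 3) ℂ)),
            (Kobs Nf R A).onTorus S v U = K (A.onTorus S v U)) :=
  GammaFiveConjObservable.stub_gammaFiveConj_observable

/-- **Stub L (v6 = v5 = v4 signature; size XL; held by the lead): the SPECTRAL light-mass core** (the registered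
signature is `OsAdjointChargeStmt → SupercommuteStmt → …` unfolded; the bridge `lightCore_stmt` additionally
receives E1, E2, E4 and (v6) K0, K1, K1', K2, whose landed files the residual's prover imports).  The
Haag–Lüscher theorem proper in the window `m_f(k) → (−1, m₀)`, GIVEN the charge flip (stub Θ) and graded
commutativity (stub G) as its first two hypotheses: site-RP of the Wilson action
(`WilsonQCDSiteReflectionPositivityAP_holds`) gives the positive transfer matrix at each large `k`; the neutral
composites `N_x = A · τ_x ΘA` (stubs C + Θ) obey from `k₀` on rate-`2Δ` bounds; spatial splitting `|x| → ∞`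
(stub T, regrouping by stub G) factorises the 4-point function into `c_{A}(n) c_{B}(n)`; the decay-rate-to-norm
upgrade and the return from the reflection-positive (thermal) functional to the `(−1)^F`-twisted `qcdTorusExpect`
on the tori `S ≥ L_k`, `n ≤ S` are the research-level parts (operator-level trace formula with quark insertions —
sister crux stmt-QuantumFields-9737 roadmap; symmetric-torus return priced by a low-temperature pressure bound /
non-vanishing of `Str T^{2S+1}`, NOT among the crux's hypotheses — see RESTATE-v2). -/
theorem stub_light_core_spectral :
    (∀ (Nf R : ℕ) (A : QCDLatticeObservable Nf R) (q : Fin Nf → ℤ),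
      (∀ t : Fin Nf → ℂ, (∀ f, t f ≠ 0) → ∀ U,
          QCDLatticeObservable.flavourScale t (A.F U) = (∏ f, t f ^ (q f)) • A.F U) →
      ∀ t : Fin Nf → ℂ, (∀ f, t f ≠ 0) → ∀ U,
          QCDLatticeObservable.flavourScale t (A.osAdjoint.F U) =
            (∏ f, t f ^ ((-q) f)) • A.osAdjoint.F U) →
    (∀ (Nf R R' : ℕ) (A : QCDLatticeObservable Nf R) (B : QCDLatticeObservable Nf R') (qA qB : Fin Nf → ℤ),
      (∀ t : Fin Nf → ℂ, (∀ f, t f ≠ 0) → ∀ U,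
          QCDLatticeObservable.flavourScale t (A.F U) = (∏ f, t f ^ (qA f)) • A.F U) →
      (∀ t : Fin Nf → ℂ, (∀ f, t f ≠ 0) → ∀ U,
          QCDLatticeObservable.flavourScale t (B.F U) = (∏ f, t f ^ (qB f)) • B.F U) →
      ∀ (S : ℕ) [NeZero S] (u v : _root_.Literature.Probability.LatticeModels.Site 4)
        (U : GaugeConfig 4 S (Matrix.specialUnitaryGroup (Fin 3) ℂ)),
        A.onTorus S u U * B.onTorus S v U =
          ((-1 : ℂ) ^ ((∑ f, qA f) * (∑ f, qB f)).natAbs) • (B.onTorus S v U * A.onTorus S u U)) →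
    ∀ (Nf : ℕ) (sch : QCDScheme Nf) (Δ : ℝ), 0 < Δ → 0 < betaCoeff₀ Nf → sch.HasAsymptoticScaling →
      (∀ fl : Fin Nf, ∀ᶠ k in atTop, -1 < sch.mq fl k) →
      (¬ ∃ m₀ : ℝ, 0 < m₀ ∧ ∀ fl : Fin Nf, ∀ᶠ k in atTop, m₀ ≤ sch.mq fl k) →
      (∃ k₀ : ℕ, ∀ (i : Fin 4) (R R' : ℕ) (A : QCDLatticeObservable Nf R) (B : QCDLatticeObservable Nf R'),
          A.IsFlavourNeutral → B.IsFlavourNeutral → ∃ C : ℝ, ∀ k : ℕ, k₀ ≤ k →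
            ∀ S : ℕ, sch.L k ≤ S → ∀ n : ℕ, n ≤ S →
              ‖qcdTorusExpect (sch.β k) (2 * S + 1) (fun fl => sch.mq fl k)
                    (fun U => A.onTorus (2 * S + 1) 0 U *
                      B.onTorus (2 * S + 1) (Pi.single i (n : ℤ)) U) -
                  qcdTorusExpect (sch.β k) (2 * S + 1) (fun fl => sch.mq fl k) (A.onTorus (2 * S + 1) 0) *
                    qcdTorusExpect (sch.β k) (2 * S + 1) (fun fl => sch.mq fl k)
                      (B.onTorus (2 * S + 1) (Pi.single i (n : ℤ)))‖ ≤
                C * Real.exp (-(2 * Δ * (sch.a k * n)))) →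
      (∀ (R R' : ℕ) (A : QCDLatticeObservable Nf R) (B : QCDLatticeObservable Nf R')
          (v : _root_.Literature.Probability.LatticeModels.Site 4),
          ∃ (R'' : ℕ) (N : QCDLatticeObservable Nf R''),
            (∀ (S : ℕ) (u : _root_.Literature.Probability.LatticeModels.Site 4)
                (U : GaugeConfig 4 (2 * S + 1) (Matrix.specialUnitaryGroup (Fin 3) ℂ)),
                N.onTorus (2 * S + 1) u U =
                  A.onTorus (2 * S + 1) u U * B.onTorus (2 * S + 1) (u + v) U) ∧
            ∀ qA qB : Fin Nf → ℤ,
              (∀ t : Fin Nf → ℂ, (∀ f, t f ≠ 0) → ∀ U,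
                  QCDLatticeObservable.flavourScale t (A.F U) = (∏ f, t f ^ (qA f)) • A.F U) →
              (∀ t : Fin Nf → ℂ, (∀ f, t f ≠ 0) → ∀ U,
                  QCDLatticeObservable.flavourScale t (B.F U) = (∏ f, t f ^ (qB f)) • B.F U) →
              ∀ t : Fin Nf → ℂ, (∀ f, t f ≠ 0) → ∀ U,
                  QCDLatticeObservable.flavourScale t (N.F U) = (∏ f, t f ^ ((qA + qB) f)) • N.F U) →
      ∀ (R R' : ℕ) (A : QCDLatticeObservable Nf R) (B : QCDLatticeObservable Nf R') (q : Fin Nf → ℤ),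
        (∀ t : Fin Nf → ℂ, (∀ f, t f ≠ 0) → ∀ U,
            QCDLatticeObservable.flavourScale t (A.F U) = (∏ f, t f ^ (q f)) • A.F U) →
        (∀ t : Fin Nf → ℂ, (∀ f, t f ≠ 0) → ∀ U,
            QCDLatticeObservable.flavourScale t (B.F U) = (∏ f, t f ^ ((-q) f)) • B.F U) →
        q ≠ 0 →
          ∃ C : ℝ, ∀ᶠ k in atTop, ∀ S : ℕ, sch.L k ≤ S → ∀ n : ℕ, n ≤ S →
            ‖qcdLatticeConnectedCorr (sch.β k) (2 * S + 1) (fun fl => sch.mq fl k) A B n‖ ≤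
              C * Real.exp (-(Δ * (sch.a k * n))) := by
  sorry

/-! ### Bridges: the registered (unfolded) stubs are the §1 statements -/

/-- Stub 1 is `HomogeneousReductionStmt` (definitional unfolding). -/
theorem homogeneousReduction_stmt : HomogeneousReductionStmt := stub_homogeneous_reduction

/-- Stub 2 is `NeutralUniformisationStmt` (definitional unfolding). -/
theorem neutralUniformisation_stmt : NeutralUniformisationStmt := stub_neutral_threshold_uniformisation

/-- Stub 3a is `SelectionRuleStmt` (definitional unfolding). -/
theorem selectionRule_stmt : SelectionRuleStmt := stub_selection_rule

/-- Stub T is `TransportStmt` (definitional unfolding). -/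
theorem transport_stmt : TransportStmt := stub_neutral_gap_along_axes

/-- Stub D is `DetPosStmt`. -/
theorem detPos_stmt : DetPosStmt := stub_det_diracMatrix_pos

/-- Stub P is `HeavyPathwiseStmt` (definitional unfolding). -/
theorem heavyPathwise_stmt : HeavyPathwiseStmt := stub_conjugate_heavy_pathwise

/-- Stub H is `HeavyStmt` (definitional unfolding). -/
theorem heavy_stmt : HeavyStmt := stub_conjugate_heavy

/-- Stub C is `CompositeStmt` (definitional unfolding). -/
theorem composite_stmt : CompositeStmt := stub_composite_observable

/-- Stub Θ is `OsAdjointChargeStmt` (definitional unfolding). -/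
theorem osAdjointCharge_stmt : OsAdjointChargeStmt := stub_osAdjoint_charge

/-- Stub G is `SupercommuteStmt` (definitional unfolding). -/
theorem supercommute_stmt : SupercommuteStmt := stub_homogeneous_supercommute

/-- Stub E1 is `FourPointRegroupStmt` (definitional unfolding). -/
theorem fourPointRegroup_stmt : FourPointRegroupStmt := stub_fourPoint_regrouping

/-- Stub E2 is `ChargedTransportStmt` (definitional unfolding). -/
theorem chargedTransport_stmt : ChargedTransportStmt := stub_charged_axis_transport

/-- Stub E4 is `HaagProductBoundStmt`. -/
theorem haagProductBound_stmt : HaagProductBoundStmt := stub_haag_product_bound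

/-- Stub K0 is `ConjugationExistsStmt` (definitional unfolding). -/
theorem conjugationExists_stmt : ConjugationExistsStmt := stub_gammaFiveConj_exists

/-- Stub K1 is `ConjugationExpectStmt` (definitional unfolding). -/
theorem conjugationExpect_stmt : ConjugationExpectStmt := stub_gammaFiveConj_expect

/-- Stub K1' is `ConjugationExpectAPStmt` (definitional unfolding). -/
theorem conjugationExpectAP_stmt : ConjugationExpectAPStmt := stub_gammaFiveConj_expectAP

/-- Stub K2 is `ConjugationObservableStmt` (definitional unfolding). -/
theorem conjugationObservable_stmt : ConjugationObservableStmt := stub_gammaFiveConj_observable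

/-- Stub L is `LightCoreStmt` (definitional unfolding; in the Lean statement of stub L the composite
hypothesis is specialised to the scheme's `N_f`, which `CompositeStmt`'s global form implies; the inputs
E1, E2, E4 and (v6) K0, K1, K1', K2 are received by the bridge and consumed by the residual's prover through
their landed files). -/
theorem lightCore_stmt : LightCoreStmt :=
  fun hΘ hG _hE1 _hE2 _hE4 _hK0 _hK1 _hK1' _hK2 Nf sch Δ hΔ hb hAS hbr hlight hT hC =>
    stub_light_core_spectral hΘ hG Nf sch Δ hΔ hb hAS hbr hlight hT (hC Nf)

/-! ## §3 Proved ingredients -/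

/-- Homogeneity of charge `0` is flavour-neutrality. -/
theorem isFlavourNeutral_of_homogeneous_zero {Nf R : ℕ} {A : QCDLatticeObservable Nf R}
    {q : Fin Nf → ℤ} (hA : IsFlavourHomogeneous A q) (hq : q = 0) : A.IsFlavourNeutral := by
  intro t ht U
  have h := hA t ht U
  subst hq
  simpa using h

/-- **From the product bound to the half rate** (how E4 is used once a charge-conjugation partner with EQUAL
diagonal correlator is available): `M ≥ 0`, `a_n · a_n ≤ M² (r²)ⁿ` for all `n` give `a_n ≤ M rⁿ`. -/
theorem le_mul_pow_of_sq_le {a : ℕ → ℝ} {M r : ℝ} (hr : 0 ≤ r) (hM : 0 ≤ M)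
    (h : ∀ n, a n * a n ≤ M ^ 2 * (r ^ 2) ^ n) (n : ℕ) : a n ≤ M * r ^ n := by
  have hb : 0 ≤ M * r ^ n := mul_nonneg hM (pow_nonneg hr n)
  have hsq : a n * a n ≤ (M * r ^ n) * (M * r ^ n) := by
    calc a n * a n ≤ M ^ 2 * (r ^ 2) ^ n := h n
      _ = (M * r ^ n) * (M * r ^ n) := by rw [← pow_mul, mul_comm 2 n, pow_mul]; ring
  nlinarith [hsq, hb]

/-- **The charge-conjugation partner (v6; how K0–K2 enter Haag's argument).**  From the three landed
conjugation statements: every flavour-homogeneous observable `A` of charge `q` has a partner `A'` (namely `A^K`)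
of charge `−q` whose RP-pairings `⟨ΘA'(u) · A'(v)⟩` in BOTH torus functionals are the complex conjugates of those
of `A` — so the RP-diagonal correlators (real by reflection positivity) of `A` and `A'` coincide, and the product
bound E4/E5 `d_A(n) · d_{A'}(n) ≤ M² r^{2n}` becomes the half rate `d_A(n) ≤ M rⁿ` (`le_mul_pow_of_sq_le`). -/
theorem conjugatePartner_of_stmts (hK0 : ConjugationExistsStmt) (hK1 : ConjugationExpectStmt)
    (hK1' : ConjugationExpectAPStmt) (hK2 : ConjugationObservableStmt)
    {Nf R : ℕ} (A : QCDLatticeObservable Nf R) (qA : Fin Nf → ℤ) (hA : IsFlavourHomogeneous A qA) :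
    ∃ A' : QCDLatticeObservable Nf R, IsFlavourHomogeneous A' (-qA) ∧
      ∀ (β : ℝ) (S : ℕ) [NeZero S] (mq : Fin Nf → ℝ)
        (u v : _root_.Literature.Probability.LatticeModels.Site 4),
        qcdTorusExpectAP β S mq (fun U => A'.osAdjoint.onTorus S u U * A'.onTorus S v U) =
            starRingEnd ℂ (qcdTorusExpectAP β S mq (fun U => A.osAdjoint.onTorus S u U * A.onTorus S v U)) ∧
          qcdTorusExpect β S mq (fun U => A'.osAdjoint.onTorus S u U * A'.onTorus S v U) =
            starRingEnd ℂ (qcdTorusExpect β S mq (fun U => A.osAdjoint.onTorus S u U * A.onTorus S v U)) := by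
  obtain ⟨Kobs, hflip, _hΘF, hΘ, hplace⟩ := hK2
  refine ⟨Kobs Nf R A, hflip Nf R A qA hA, fun β S _ mq u v => ?_⟩
  obtain ⟨K, hK⟩ := hK0 Nf S
  have hmul : ∀ x y, K (x * y) = K x * K y := hK.1
  have hfun : (fun U => (Kobs Nf R A).osAdjoint.onTorus S u U * (Kobs Nf R A).onTorus S v U) =
      fun U => K (A.osAdjoint.onTorus S u U * A.onTorus S v U) := by
    funext U
    rw [hΘ Nf R A S u U, hplace Nf R A.osAdjoint S K hK u U, hplace Nf R A S K hK v U, hmul]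
  rw [hfun]
  exact ⟨(hK1' Nf S K hK).2 β mq _, (hK1 Nf S K hK).2 β mq _⟩

/-! ## §4 The kernel-checked composition -/

/-- **Conjugate pairs from the v3 stubs**: heavy corner, or else the light core fed by the transported
common-threshold neutral gap and the composites. -/
theorem conjugateHalfSpectrum_of :
    TransportStmt → HeavyStmt → DetPosStmt → HeavyPathwiseStmt → CompositeStmt →
      OsAdjointChargeStmt → SupercommuteStmt → FourPointRegroupStmt → ChargedTransportStmt →
        HaagProductBoundStmt → ConjugationExistsStmt → ConjugationExpectStmt → ConjugationExpectAPStmt →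
          ConjugationObservableStmt → LightCoreStmt → ConjugateHalfSpectrumStmt := by
  intro hT hH hD hP hC hΘ hG hE1 hE2 hE4 hK0 hK1 hK1' hK2 hL Nf sch Δ hΔ hb hAS hbranch hU R R' A B q hA hB hq
  by_cases hheavy : HeavyCorner sch
  · exact hH hD hP Nf sch Δ hΔ hheavy R R' A B q hA hB hq
  · obtain ⟨k₀, hk₀⟩ := hU
    exact hL hΘ hG hE1 hE2 hE4 hK0 hK1 hK1' hK2 Nf sch Δ hΔ hb hAS hbranch hheavy
      ⟨k₀, hT Nf sch (2 * Δ) k₀ hk₀⟩ hC R R' A B q hA hB hq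

/-- The conjugate-pair half-spectrum statement, from the registered v6 stubs. -/
theorem conjugateHalfSpectrum_stmt : ConjugateHalfSpectrumStmt :=
  conjugateHalfSpectrum_of transport_stmt heavy_stmt detPos_stmt heavyPathwise_stmt composite_stmt
    osAdjointCharge_stmt supercommute_stmt fourPointRegroup_stmt chargedTransport_stmt
    haagProductBound_stmt conjugationExists_stmt conjugationExpect_stmt conjugationExpectAP_stmt
    conjugationObservable_stmt lightCore_stmt

/-- **Charged pairs from the selection rule and the conjugate-pair statement.**  If the charges are not
opposite, the selection rule; otherwise `q_B = −q_A` with `q_A ≠ 0` (else both vanish). -/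
theorem chargedHalfSpectrum_of :
    SelectionRuleStmt → ConjugateHalfSpectrumStmt → ChargedHalfSpectrumStmt := by
  intro hsel hconj Nf sch Δ hΔ hb hAS hbranch hU R R' A B qA qB hA hB hq
  by_cases hsum : qA + qB = 0
  · have hqB : qB = -qA := eq_neg_of_add_eq_zero_right hsum
    have hqA : qA ≠ 0 := by
      rcases hq with h | h
      · exact h
      · intro h0
        exact h (by rw [hqB, h0, neg_zero])
    subst hqB
    exact hconj Nf sch Δ hΔ hb hAS hbranch hU R R' A B qA hA hB hqA
  · exact hsel Nf sch Δ R R' A B qA qB hA hB hsum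

/-- The charged half-spectrum statement, from the registered stubs (no longer a stub itself). -/
theorem chargedHalfSpectrum_of_stubs : ChargedHalfSpectrumStmt :=
  chargedHalfSpectrum_of selectionRule_stmt conjugateHalfSpectrum_stmt

/-- **Assembly.** `TorusHalfSpectrum` from the stubs: reduce to homogeneous pairs; the doubly-neutral
case is the crux's own neutral hypothesis at rate `2Δ ≥ Δ`; every pair carrying charge is the charged
half-spectrum fed by the common threshold of stub 2. -/
theorem TorusHalfSpectrum_of :
    HomogeneousReductionStmt → NeutralUniformisationStmt → ChargedHalfSpectrumStmt →
      TorusHalfSpectrum := by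
  intro hred hunif hhalf Nf sch Δ hΔ hb hAS hbranch hneutral
  -- the crux's inlined neutral hypothesis is `HasNeutralLatticeMassGap (2Δ)` by `Iff.rfl`
  have hN : sch.HasNeutralLatticeMassGap (2 * Δ) := hneutral
  have hU : UniformNeutralGap sch (2 * Δ) := hunif Nf sch Δ hΔ hb hAS hbranch hN
  refine hred Nf sch Δ fun R R' A B qA qB hA hB => ?_
  by_cases hq : qA = 0 ∧ qB = 0
  · -- both neutral: the hypothesis itself, at the weaker rate Δ ≤ 2Δ
    have hA0 : A.IsFlavourNeutral := isFlavourNeutral_of_homogeneous_zero hA hq.1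
    have hB0 : B.IsFlavourNeutral := isFlavourNeutral_of_homogeneous_zero hB hq.2
    exact (hN.mono (by linarith)) R R' A B hA0 hB0
  · exact hhalf Nf sch Δ hΔ hb hAS hbranch hU R R' A B qA qB hA hB (not_and_or.mp hq)

/-- The crux by name, from the stubs. -/
theorem torusHalfSpectrum_of_stubs : TorusHalfSpectrum :=
  TorusHalfSpectrum_of homogeneousReduction_stmt neutralUniformisation_stmt chargedHalfSpectrum_of_stubs

/-! ## §5 Route-repair view (for the tenure planner)

The crux AS FILED needs stub 2 (misstated).  With the common threshold written into the hypothesis — the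
repair both leads recommend — the crux is closed MODULO EXACTLY ONE STUB, the light core: -/

/-- **The repaired crux** (proposal): `TorusHalfSpectrum` with the per-pair neutral hypothesis
`HasNeutralLatticeMassGap (2Δ)` (`∀ pairs, ∃ C, ∀ᶠ k`) replaced by the common-threshold form
`UniformNeutralGap sch (2Δ)` (`∃ k₀, ∀ pairs, ∃ C, ∀ k ≥ k₀`), everything else verbatim. -/
def TorusHalfSpectrumRepaired : Prop :=
  ∀ (Nf : ℕ) (sch : QCDScheme Nf) (Δ : ℝ), 0 < Δ → 0 < betaCoeff₀ Nf → sch.HasAsymptoticScaling →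
    (∀ fl : Fin Nf, ∀ᶠ k in atTop, -1 < sch.mq fl k) → UniformNeutralGap sch (2 * Δ) →
      sch.HasLatticeMassGap Δ

/-- A common threshold is in particular a per-pair threshold. -/
theorem hasNeutralLatticeMassGap_of_uniform {Nf : ℕ} {sch : QCDScheme Nf} {Δ' : ℝ}
    (h : UniformNeutralGap sch Δ') : sch.HasNeutralLatticeMassGap Δ' := by
  obtain ⟨k₀, hk₀⟩ := h
  intro R R' A B hA hB
  obtain ⟨C, hC⟩ := hk₀ R R' A B hA hB
  exact ⟨C, Filter.eventually_atTop.2 ⟨k₀, fun k hk => hC k hk⟩⟩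

/-- The crux as filed implies the repaired crux (the repair only strengthens the hypothesis). -/
theorem torusHalfSpectrumRepaired_of_torusHalfSpectrum (h : TorusHalfSpectrum) :
    TorusHalfSpectrumRepaired :=
  fun Nf sch Δ hΔ hb hAS hbranch hU =>
    h Nf sch Δ hΔ hb hAS hbranch (hasNeutralLatticeMassGap_of_uniform hU)

/-- **The repaired crux is closed modulo the light core alone**: reduction to homogeneous pairs (landed),
the doubly-neutral case (hypothesis), the selection rule (landed), the heavy corner (landed), the transport
and the composites (landed) — and `LightCoreStmt`. -/
theorem torusHalfSpectrumRepaired_of_lightCore (hL : LightCoreStmt) : TorusHalfSpectrumRepaired := by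
  intro Nf sch Δ hΔ hb hAS hbranch hU
  have hconj : ConjugateHalfSpectrumStmt :=
    conjugateHalfSpectrum_of transport_stmt heavy_stmt detPos_stmt heavyPathwise_stmt composite_stmt
      osAdjointCharge_stmt supercommute_stmt fourPointRegroup_stmt chargedTransport_stmt
      haagProductBound_stmt conjugationExists_stmt conjugationExpect_stmt conjugationExpectAP_stmt
      conjugationObservable_stmt hL
  have hhalf : ChargedHalfSpectrumStmt := chargedHalfSpectrum_of selectionRule_stmt hconj
  have hN : sch.HasNeutralLatticeMassGap (2 * Δ) := hasNeutralLatticeMassGap_of_uniform hU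
  refine homogeneousReduction_stmt Nf sch Δ fun R R' A B qA qB hA hB => ?_
  by_cases hq : qA = 0 ∧ qB = 0
  · exact (hN.mono (by linarith)) R R' A B (isFlavourNeutral_of_homogeneous_zero hA hq.1)
      (isFlavourNeutral_of_homogeneous_zero hB hq.2)
  · exact hhalf Nf sch Δ hΔ hb hAS hbranch hU R R' A B qA qB hA hB (not_and_or.mp hq)

/-- **The heavy corner of the crux AS FILED is proved outright** (LANDED p166446 as the registered sub-goal
`…Birth.HeavyCornerHalfSpectrum.stub_heavyCorner_halfSpectrum`; no threshold uniformisation, no asymptotic scaling, no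
branch condition): for a scheme with one positive lower bound on all bare masses eventually, the per-pair neutral
hypothesis at rate `2Δ` already gives `HasLatticeMassGap Δ` — reduction (stub 1), neutral pairs (hypothesis, `Δ ≤ 2Δ`),
selection rule (stub 3a), and the unconditional heavy corner (stubs D, P, H). -/
theorem torusHalfSpectrum_heavyCorner (Nf : ℕ) (sch : QCDScheme Nf) (Δ : ℝ) (hΔ : 0 < Δ)
    (hheavy : HeavyCorner sch) (hN : sch.HasNeutralLatticeMassGap (2 * Δ)) : sch.HasLatticeMassGap Δ :=
  HeavyCornerHalfSpectrum.stub_heavyCorner_halfSpectrum Nf sch Δ hΔ hheavy hN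

/-- In particular `TorusHalfSpectrum`'s implication holds verbatim for every heavy-corner scheme (the filed
hypotheses `0 < b₀`, asymptotic scaling and the branch condition are not even needed there). -/
theorem torusHalfSpectrum_of_heavyCorner (Nf : ℕ) (sch : QCDScheme Nf) (Δ : ℝ) (hΔ : 0 < Δ)
    (hheavy : HeavyCorner sch) (_hb : 0 < betaCoeff₀ Nf) (_hAS : sch.HasAsymptoticScaling)
    (_hbranch : ∀ fl : Fin Nf, ∀ᶠ k in atTop, -1 < sch.mq fl k)
    (hN : sch.HasNeutralLatticeMassGap (2 * Δ)) : sch.HasLatticeMassGap Δ :=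
  torusHalfSpectrum_heavyCorner Nf sch Δ hΔ hheavy hN

end Summit.QuantumFields.QCD.Cruxes.TorusHalfSpectrum.Birth

end
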